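import Summits.HodgeConjecture.HodgeConjecture.Cruxes.BlochSeedDiscOne.SeedCheckerSplitBlockCFree
import Summits.HodgeConjecture.HodgeConjecture.Cruxes.BlochSeedDiscOne.KunnethNoInterference
import Summits.HodgeConjecture.HodgeConjecture.Cruxes.BlochSeedDiscOne.KunnethNoInterferenceDatumLaw
import Summits.HodgeConjecture.HodgeConjecture.Cruxes.BlochSeedDiscOne.StaticAlongTWDatumLaw
import Summits.HodgeConjecture.HodgeConjecture.Cruxes.BlochSeedDiscOne.SeedCheckerSplitBlockLetterBundle
import Summits.HodgeConjecture.HodgeConjecture.Cruxes.BlochSeedDiscOne.SplitBlockClassRows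
import Summits.HodgeConjecture.HodgeConjecture.Cruxes.BlochSeedDiscOne.SeedCheckerSplitBlockPicZeroPin

/-!
# Line `splitblock` — SECOND skeleton line for the crux `EightfoldBlochSeeds.BlochSeedDiscOne`
# (item stmt-HodgeConjecture-18881, route route-HodgeConjecture-EightfoldBlochSeeds, FRONTIER) — v4 = THE g3 (R-a) TOUCH of v3 (sha16 913fcfc89bbd08ef, g2)
# (planner `cruxplan-18881-splitblock` g3, 2026-08-31; director-hodge R19.894 (R-a), R19.900 (content), R19.901 (fuse (T-g3′) (a)(b)(c) + v4 CONTENT),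
# R19.902 (self-certification); officer AUDIT 136 acceptance list + AUDIT 138 = R-4 of this file; v3's touch list R19.888 (1)–(5) ∕ (P′) R19.889 ∕
# (W″) R19.891 ∕ (W‴) R19.892 ∕ (P″) R19.894 (R-b) ∕ (Φ′)(ii) R19.898 and v2's rulings R19.841 (A)(C3), R19.845 (O1), R19.862 (B′), R19.864 (B″), R19.865,
# R19.867 (c) stand).  Imports, all under `Cruxes/BlochSeedDiscOne/` (= v3's + v42.4): typing spec `SeedCheckerSplitBlockCFree.lean` v42.1 1bcdc3c1de7a79a0
# (hsemireg-c5c8-1 g54); budget names `KunnethNoInterference.lean` 47e2ff3c1f7b1e52 + law adapter `KunnethNoInterferenceDatumLaw.lean` b8460116ae47a551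
# (semihom-1 g66 ∕ g67); layer B `StaticAlongTWDatumLaw.lean` 180e709cc9cece30 (semihom-1 g68); the ORIGIN PIN `SeedCheckerSplitBlockLetterBundle.lean`
# v42.3 845643cddb00db48 (c5c8-1 g55); `SplitBlockClassRows.lean` (sheaf8-1 g10; v1.1 0303529ad98e0424); **v42.4 `SeedCheckerSplitBlockPicZeroPin.lean`
# 65704d1ec475419c (c5c8-1 g55; BUILT LD l.24087; officer AUDIT 137 PLATE #112 PASS 82∕82 std): the `Pic⁰`-DECORATED ORIGIN PIN `originPicZeroLaw := decLaw picZero`**.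
# Supersedes v3 913fcfc89bbd08ef (g2), v2 ab08aaed15d375b0 (g1) and v1 e0d163081e96 (g0).

Token of the line of record (UNTOUCHED by this file): `line stmt-HodgeConjecture-18881 Cruxes/BlochSeedDiscOne/Lines/birth.lean
814a6a70c14e831a stub_rung_pad4_seedAt`.

## Honest framing (read first)

NOTHING toward HC ∕ HC_CM (HELD 3052) ∕ HC_AV ∕ № 4 ∕ 26512 ∕ 18881 ∕ H2 is proved here.  This file is STAFFING ON A MODEL: it registers the
split two-term LETTER-BLOCK ANSATZ for the stub of record as C-FREE stubs in the v42.1 currency (`SplitBlock.SplitBlockDatum₀`, `Rung2a₀`,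
`Rung2b₀Under`), so that the letter sieve (Leg A) and the seed-checker lanes (Leg B) have kernel targets that are NOT the crux.  The crux
`BlochSeedDiscOne := HasHyperbolicBlochSeed 4 1` and `Birth.stub_rung_pad4_seedAt` stay exactly as open as before; no design json, block,
frame, section or seed is constructed here; letters ≠ sheaves ≠ SEED; typed ≠ proved.

**COSTUME DECLARED (officer AUDIT 123, hsem l.13551; R19.864): the on-path content of `Rung2a₀` is `Passes.1` = `CoreCert` = the crux at one
CM anchor in json clothing (v41 FLAG); this line's registered use is the kill path, which refutes split-block PRESENTATIONS only — never
`¬ BlochSeedDiscOne`, never the crux.**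

## The line (v4 = v3's shape after the g3 (R-a) touch: the four sorried row stubs RE-GUARDED under the `Pic⁰`-decorated origin pin `originPicZeroLaw` — STRONGER
## stubs, WIDER kill reach; class rows CLOSED by citation; ROW α1 a per-selector HYPOTHESIS; laws of record `lawSigma S` (v3) and `lawSigmaPic S` (v4))

ON PATH (one stub, C-FREE, R19.845 (O1)): `stub_rung2a : Rung2a₀ 14` — on SOME CM anchor `(E₀, ψ₀)`, `ψ₀² = −1`, a C-free split-block datum
`δ₀` (anchor kit + linked word frame; SHELL design json `Dsh`; the block `0 → 𝓟 → 𝓝 → 𝓔 → 0` with both terms split into rank-`≤ 1` letter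
modules indexed by `Dsh`'s cells; the frame `0 → 𝒪^k → 𝓔 → Q → 0`, `rank Q = 4`; a section `s` of `Q`; the presented subscheme `i : Z → S⁴`)
with POSITIVE shell multiplicities, which PASSES (`(∃ q, (Dsh.padApexUp 0 k).SeedCheck K i q) ∧ IsZeroSchemeOf s i`: C0 ∧ C5 ∧ C6 ∧ C7 ∧ (σ)),
and whose shell shadow is IN SCOPE (`ScopeRows 14` = READING-1 normal form: height-14 alphabet, disjoint supports).  Composition (kernel,
sorry only through the stub): `BlochSeedDiscOne_of := blochSeedDiscOne_of_rung2a₀ stub_rung2a` — type LITERALLY the route decl.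

OFF PATH = THE KILL PATH (RUNG 2b₀, rows v42 of record `ShadowRows₀ LeggedFloor.RuleD lawPP σ π` =
`A1 ∧ μ ≠ 0 ∧ RuleD ∧ HallUp ∧ lawPP ∧ HallPlusLegUp ∧ 4 ≤ rank ∧ BudgetClause σ π`, height 14; instance of record `Rung2b₀Lci Λ σ π`):
every row is claimed INSIDE THE GUARD and only there — for EVERY CM anchor and EVERY C-free datum `δ₀` with
  `Λ δ₀` (the law slot, a PARAMETER `Λ : SplitBlock.DatumLaw`) → `δ₀.Dsh.Positive` (F7) → `δ₀.Passes` → `ScopeRows 14 δ₀.Dsh.shadow` (F6) → ROW(`δ₀.Dsh.shadow`)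
(hsem-2 MEMO-177 (2)(4): scope and positivity are ANTECEDENTS, never conclusions — unguarded, identity padding `padBoth` and frame padding
`𝓔 ⊕ 𝒪^m` defeat every row list).  Inside the guard the rows are claimed for EVERY in-scope positive letter-split presentation of a passing seed,
not for some well-chosen one (MEMO-177 residual: a passing seed with a rogue in-scope presentation kills the ROW STUB, itself a Leg-B lead).
Registered row stubs (this file; the presentation guard instantiated HONESTLY per row — see F8 below; v4 = the g3 (R-a) touch: guard token of record on
the four sorried rows `originPicZeroLaw E₀ ψ₀ δ` — v42.4's `Pic⁰`-DECORATED ORIGIN PIN, «every letter ≅ the origin letter bundle OF ITS OWN CELL ⊗ a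
homogeneous rank-one module» — in the slot where v3 had `originLaw E₀ ψ₀ δ` and v2 the tie `δ₀.Realisable`; `originLaw ⇒ originPicZeroLaw`
(`originPicZeroLaw_of_originLaw`), so each re-guarded stub is a STRONGER statement and every v3 record ∕ repackaging is DERIVED from it below):
* `stub_classRows` (law-free) — **CLOSED BY CITATION** of `ClassRows.stub_classRows` (hsemireg-sheaf8-1 g10, `SplitBlockClassRows.lean`, sorry-free, std
  axioms; officer AUDIT 129 PLATE #104 PASS; touch item (1)): `A1 ∧ μ ≠ 0 ∧ 4 ≤ rank` of the shadow — the json ↔ letter-model dictionary under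
  `Design.shadow` (C0 of the class design `Dsh.padApexUp 0 k`: `padApexUp_mu ∕ _rank ∕ _clean`, `cellCoef_shadowCell`; positivity makes `Int.toNat`
  faithful).  Name and registered signature persist VERBATIM (the unused `ScopeRows 14` antecedent included — nit n2: it is the registered type;
  `ClassRows.classRows_of_passes` is the minimal form).
* `stub_hallRow`, `stub_ppRow`, `stub_legRow` (under the `Pic⁰`-DECORATED ORIGIN PIN `originPicZeroLaw E₀ ψ₀ δ₀` of v42.4, (R-a) R19.894 ∕ R19.900 —
  in the slot where v3 had v42.3's `originLaw` ((P′) R19.889 (i)) and v2 the realisation tie `δ₀.Realisable`; rows 5 ∕ 6 ∕ 6′ read the SHADOW only,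
  decoration-blind: pen confirms negation g26 NOTE-4 (hsem l.13954), c5c8-1 g55 RESULT-5 (l.13939), (f7-4) booked R19.900): Hall [row 5] by König–Hall
  on the zero pattern of the block matrix (`LetterHomVanishing₀ → DeadEntriesVanish`,
  fibrewise injectivity of `𝓟 → 𝓝`); LAW PP [row 6] = Whitney per closed receiver set (`PatternedPorteous`, THEOREM A∕B: pen ×1 + independent numerics
  ×2, R19.875); the LEG row [6′] (`PortHallLeg.HallPlusLegUp`, FLAGGED R19.859: theorem-grade on uniform-leg ∕ leg-free-star column sets, multi-column
  (MS) OPEN).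
* `stub_extBudget` (under the `Pic⁰`-decorated origin pin, with the other three — DIRECTION CHECK (T-g3′)(c), R19.901: `KunnethNoInterference.lean`
  47e2ff3c1f7b1e52 l.120–121 `def ExtBudgetRow (π : ℤ) (D' : Design) (𝓔 …) : Prop := (ext2 𝓔 : ℤ) + 28 * (D'.rank - 4) + π ≤ 3136` — the datum's
  sheaf `δ.S.X₃` enters ONLY through `ext2 𝓔`, bounded ABOVE by shadow data («r(X₃) ≤ f(shadow)», case 1); the attained-ceiling sentence `sigmaH D' ≤
  (ext2 𝓔 : ℤ)` is the LAW `KunnethNoInterference` (l.115–116 = `lawKNI`), never a row): the GEOMETRIC ROW `dim Ext²(𝓔,𝓔) + 28·(rank − 4) + 0 ≤ 3136 =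
  h^{3,5}(S⁴)` for the block's cokernel
  `𝓔 = δ₀.S.X₃` (semihom-1 g66 THEOREM A′ ∕ C, PEN) — a STUB TARGET, never a law (R19.865 (d)); it reads the datum's own sheaf, not only the shadow
  (nit n1); the letter clause of row 8 then follows from a FLOOR LAW by kernel one-liners of `KunnethNoInterference.lean`: (8σ) `KunnethNoInterference
  δ₀.Dsh.shadow δ₀.S.X₃` (= `σ_H ≤ ext²`, the named law of R19.847, a HYPOTHESIS in the law slot; the adapter's `kniLaw`) gives `BudgetClause sigmaH 0`
  (`budgetClause_sigmaH_of_kni`); (8♮⁺) LEMMA Δ's decoration-free floor `PhiAllPlusFloor` (pen theorem-grade, in the law slot until kernel; the adapter's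
  `phiAllPlusFloorLaw`) gives `BudgetClause phiAllPlus 0` (`budgetClause_phiAllPlus_of_floor`); B136-shadowed data are excluded decoration-free
  (`shadow_ne_B136_of_floor`, via `not_extBudgetRow_B136`).
* ROW α1 (`LeggedFloor.RuleD`) is a LAW-ROW under the named C-free law `StaticAlongTW.StaticAlongTW W` (R19.858 (b); layer B `StaticAlongTWDatumLaw.lean`
  180e709cc9cece30, semihom-1 g68, BUILT) over a tangent-family SELECTOR `W : StaticAlongTW.TangentFamilySelector`.  **NO α1 stub is registered**
  ((W″) R19.891 ∕ hsem-2 memo-181: `theorem stub_alpha1 (W : TangentFamilySelector) : … := by sorry` would declare a Π-constant `∀ W, …` over every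
  16-plane, ψ₀-blind — exactly what (W′) forbids, and unprovable from pen THEOREM P even if P is true).  α1 enters the kill side AS A HYPOTHESIS, per
  selector: `hα1 : Alpha1RowPinned W` — line-local vocabulary of §4 ((W‴) R19.892 (F3): `Rung2b₀Under (StaticAlongTW W ∧ originLaw) 14 RuleD`, the
  origin-pinned twin of layer B's tie-guarded `Alpha1RowTied W`; it READS `Passes` — hsem-3 memo-212 R0: the corner padding
  `Critic.alpha1Bridge_forces_levelZero` kills every `Passes`-free α1 bridge under a padding-stable law — and the pin, (P′)(i)); the 0-sorry feed
  `rung2b₀Lci_record_sigmaH_static W hα1` serves the (8σ) record with `S := StaticAlongTW.StaticAlongTW W` BY DECL NAME.  **v4 ((R-a) R19.900 ∕ R19.901):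
  `Alpha1RowPinned W` is KEPT VERBATIM; its DECORATED twin is the hypothesis SHAPE `Rung2b₀Under (lawPinnedPic (StaticAlongTW.StaticAlongTW W)) 14 RuleD`
  (`lawPinnedPic S := S ∧ originPicZeroLaw`, no new `def : Prop`), which FEEDS `Alpha1RowPinned W` by v42.4's `rung2b₀Under_and_originLaw_of_originPicZeroLaw`
  (`alpha1RowPinned_of_picPinned`) and serves the WIDER (8σ) record under `lawSigmaPic` (`rung2b₀Lci_recordPic_sigmaH_static ∕ _of_static`); the origin-guard
  `Alpha1RowPinned W` alone feeds the v3 records only (an α1 row under the decorated guard is the STRONGER hypothesis — stated as such, never assumed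
  from the weaker).**  Intended selector: the
  ψ₀-Weil tangent family — DEFINITION REQUEST D-L2a `weilTangentFamily E₀ ψ₀` (the family must depend on ψ₀, memo-181 (B4)) with the Künneth letter
  dictionary D-L2c (semihom-1 g68 memo `STATIC-ALONG-TW-semihom1-g68.md` a8fe89942c67b19b §3); when D-L2a lands as a decl,
  `stub_alpha1 : Alpha1RowPinned (weilTangentFamily …)` is registered (closed parameter; pen source THEOREM P restricted to origin-pinned presentations)
  — not before.  (COSTUME RULE R19.867 (c): a law is never `:= RuleD δ₀.Dsh.shadow` or any row.)

ASSEMBLY (sorry-free given the stubs): **v4: `rung2b₀Lci_of_stubs_pic` — for ANY law `Λ` implying the `Pic⁰`-DECORATED origin pin `originPicZeroLaw`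
and a floor `σ ≤ ext²` on its data, `Rung2b₀Under Λ 14 RuleD → Rung2b₀Lci Λ σ 0`** (specialised `rung2b₀Lci_sigmaH_of_stubs_pic ∕ _phiAllPlus_of_stubs_pic`);
v3's `rung2b₀Lci_of_stubs` — for ANY law `Λ` implying the origin pin and a floor `σ ≤ ext²` on its data,
`Rung2b₀Under Λ 14 RuleD → Rung2b₀Lci Λ σ 0` — is DERIVED from it (`originPicZeroLaw_of_originLaw`), as are (8σ) `rung2b₀Lci_sigmaH_of_stubs`
(floor = `KunnethNoInterference`) and (8♮⁺) `rung2b₀Lci_phiAllPlus_of_stubs` (floor = `PhiAllPlusFloor`); instances of record over the law PARAMETER `S`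
— **v4 (8σ) RECORD OF RECORD under the DECORATED σ-law `lawSigmaPic S δ₀ := S δ₀ ∧ originPicZeroLaw δ₀ ∧ KNI δ₀` (same conjunct order):
`rung2b₀Lci_recordPic_sigmaH : Rung2b₀Under (lawSigmaPic S) 14 RuleD → Rung2b₀Lci (lawSigmaPic S) sigmaH 0`, whose conclusion RECOVERS the v3 record's by
name through v42.4's kill-side transport `rung2b₀Under_sigma_originLaw_of_originPicZeroLaw S lawKNI` (`rung2b₀Lci_lawSigma_of_lawSigmaPic`)** — and v3's,
kept verbatim and derived:
`rung2b₀Lci_record_sigmaH : Rung2b₀Under (lawSigma S) 14 RuleD → Rung2b₀Lci (lawSigma S) sigmaH 0` with **`lawSigma S δ₀ := S δ₀ ∧ originLaw δ₀ ∧ KNI δ₀`,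
CONJUNCT ORDER `S ∧ originLaw ∧ KNI`** ((P′)(i)∕(iv): R19.865's `lawAnd StaticAlongTW kniLaw` WITH THE ORIGIN PIN ADJOINED — the pin in place of v2's
tie; = the adapter's `lawAnd S (lawAnd originLaw kniLaw)` definitionally), and `rung2b₀Lci_record_phiAllPlus` likewise with LEMMA Δ's floor
(`lawNatural S := S ∧ originLaw ∧ floor`); SELECTOR-FED ((W‴); `S := StaticAlongTW.StaticAlongTW W` by decl name; 0 sorry):
`rung2b₀Lci_record_sigmaH_static W : Alpha1RowPinned W → Rung2b₀Under (lawSigma (StaticAlongTW.StaticAlongTW W)) 14 RuleD` and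
`rung2b₀Lci_record_sigmaH_of_static W : Alpha1RowPinned W → Rung2b₀Lci (lawSigma (StaticAlongTW.StaticAlongTW W)) sigmaH 0` (+ the (8♮⁺) twins
`rung2b₀Lci_record_phiAllPlus_static ∕ rung2b₀Lci_record_phiAllPlus_of_static`); **v4 SELECTOR-FED under the decorated guard:
`rung2b₀Lci_recordPic_sigmaH_of_static W : Rung2b₀Under (lawPinnedPic (StaticAlongTW.StaticAlongTW W)) 14 RuleD → Rung2b₀Lci (lawSigmaPic (StaticAlongTW.StaticAlongTW W)) sigmaH 0`.**

KILL (sorry-free, hypothesis-carrying, law-restricted, NEVER against `DatumLaw.trivial`): `not_rung2a₀Under_of_stubs_pic` ∕ v3's `not_rung2a₀Under_of_stubs` —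
`Rung2b₀Under Λ 14 RuleD →` (Λ ⟹ decorated pin resp. pin, floor) `→ SPlus₀ LeggedFloor.RuleD lawPP 14 σ 0 → ¬ Rung2a₀Under Λ 14` (v42.1 `not_rung2a₀Under_of_rung2b₀Lci`;
records `not_rung2a₀Under_recordPic_sigmaH S` (v4, under `lawSigmaPic S`) ⟹ `not_rung2a₀Under_record_sigmaH S` (v3, under `lawSigma S`;
`not_rung2a₀Under_lawSigma_of_not_lawSigmaPic`); selector-fed `not_rung2a₀Under_recordPic_sigmaH_of_static W` ∕ `not_rung2a₀Under_record_sigmaH_of_static W`):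
a closed v42 room retires the split-block ANSATZ RESTRICTED TO THE LAW, in that row currency, at height 14 — not `Rung2a₀ 14`, not
`stub_rung_pad4_seedAt`, not the crux.  **CURRENCY ((Φ′)(ii) R19.898): the (8♮) record `not_rung2a₀Under_record_phiAllPlus` has closed-room hypothesis
`SPlus₀ RuleD lawPP 14 phiAllPlus 0`, FALSE at shell 2 (hub40 b14fa640c6e6a2ea; sheaf8-1 g10 RESULT-2, memo 3c22f0d2c0a5e783) — DEAD CURRENCY (the theorem
stays, a true implication that cannot fire as typed — officer AUDIT 135 π7); kill currency of record = (8σ) under `lawSigma`.**  **Rows read `Dsh.shadow`, which the C-free presentation does not determine (hsem-3 memo-212 (f6), this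
file's F8): a kill in this currency refutes ORIGIN-PINNED law-abiding DRESSINGS `(Dsh, k)` of split-block presentations — the laws of record carry the
C-free label pin `originLaw` ((P′) R19.889; v2 carried the C-tied realisation tie `δ₀.Realisable` — certified as a pin by hsem-3 memo-213 (B1)–(B4), but
19780-priced; the origin pin takes that price OFF the kill side).  **REACH (v4 = (R-a) R19.894 ∕ R19.900 ∕ R19.901): kills under `lawSigmaPic` REACH
PRESENTATIONS PINNED AT THE ORIGIN UP TO A `Pic⁰`-DECORATION (`letterBundle 𝒪(o) ψ₀ Z ⊗ Q_Z`, `Q_Z` homogeneous of rank one — v42.4 `picZero`: translates,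
uniform and cell-dependent degree-0 twists); what such a kill retires is the `S ∧ KNI`-abiding part of v42.4's DECORATED door `Rung2a₀PicZero 14`
(`rung2a₀PicZero_of_rung2a₀Under_lawSigmaPic`) and A FORTIORI of the pinned door (`not_rung2a₀Under_lawSigma_of_not_lawSigmaPic`); relabel-invariance of
the rows ((K2) `rows_relabel_iff_of_originPicZeroLaw`) holds modulo `OriginDecSeparating` (v42.4: origin letters separated in `NS = Pic ∕ Pic⁰`) — **NOW A
KERNEL THEOREM: `OriginSep.originDecSeparating_holds : SplitBlock.OriginDecSeparating`** (hsemireg-sheaf8-1 g10 `OriginSeparatingReduction.lean` v2.1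
9f3f39ac5dfbc894, crux commit 27a19ffe0b36, 0 sorry, std axioms — RESULT-5 hsem l.14033; via v42.5 `SeedCheckerSplitBlockDecSepWiring` 8568e1b2271e8e02
`originDecSeparating_of_invariant` instantiated by the degree invariant `degInvariant`, `degZ_pullback_hom_of_isHomogeneous` = Mumford §8 (iii); officer AUDIT 140
PLATE #119 PASS; director R19.910 RULING (O″): `OriginDecSeparating` leaves the typed-not-proved list), so **relabel-invariance up to `Pic⁰`-decoration holds
UNCONDITIONALLY (`originDecSeparating_holds`)** — known here by a docstring citation only, NOT imported (director R19.907 ∕ R19.910: no build dependency is added to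
the skeleton; AUDIT 140: the «modulo the typed-not-proved `OriginDecSeparating`» clause of the AUDIT 136 ∕ R19.901 acceptance list is RETIRED); presentations whose letters leave the `Pic⁰`-orbit of their cell's origin letter (other NS representatives do not exist;
non-homogeneous twists change the class) are not presentations of the same shadow, and GHOST ∕ RELABELLED dressings stay excluded outright ((K1)
`not_originPicZeroLaw_padZero`; `not_originPicZeroLaw_relabel_of_moves`, its `OriginDecSeparating` hypothesis discharged by `OriginSep.originDecSeparating_holds`);
v3's reach sentence ((P″) R19.894 (R-b)) stays true of the v3 records: kills under `lawSigma` bear on origin-pinned (undecorated) presentations only, and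
the decorated-to-undecorated normalisation `ReachModDec picZero 14` stays OPEN (def-only); the on-path `stub_rung2a : Rung2a₀ 14` is law-free and
unaffected — the C-free door survives any such kill formally (ghost ∕ relabelled ∕ non-`Pic⁰` dressings, `Hazard.padZero` ∕ `Hazard.relabel`); what a v3 kill
of record retires is the σ-law-abiding part of v42.3's PINNED door `Rung2a₀Origin 14` (`rung2a₀Origin_of_rung2a₀Under_lawSigma`).**  `rung2b₀Under_of_not_rung2a₀Under` records the converse reading (2b is
vacuously true off the ansatz), so given the closed room 2b-of-record ⟺ ¬(2a under Λ) (`rung2b₀Lci_iff_not_rung2a₀Under_of_sPlus₀`).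
Closed shells ∕ `SPlus`-type facts ∕ B136 audits are therefore REFUTATION TARGETS OF 2b∘2a FOR THE ANSATZ — never evidence about the crux.

## F8 — why the letter-reading rows carry a PRESENTATION PIN (planner's typing finding; = hsem-3 memo-212 HAZARD (f6) «label freedom ∕ zero
## letters», found independently and KERNEL-BENCHED there: `V42ZeroLetters.lean` c199005e96f7d9b0, `Critic.padZero` ∕ `Critic.relabel` ∕ `rung2b₀With_iff_not_rung2a₀`);
## v2: the realisation tie `δ₀.Realisable`; v3: THE C-FREE ORIGIN PIN `originLaw` ((P′) R19.889); v4: ITS `Pic⁰`-DECORATED FORM `originPicZeroLaw` OF RECORD ((R-a))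

In the C-free core a letter module is only `HasRankLE (L Z) 1` (v42.1 `LetterKit₀.rankLEOne`) and NO sentence ties `L Z` to the cell `Z` (the
modelling sentence `ch(L_Z) = ch(Z)` lives in `LetterKit₀.Realises C`, off path).  Hence `L Z = 0` (a GHOST letter) is admissible, and cells can be
RELABELLED freely as long as the class design keeps C0 and `μ`: from any positive passing in-scope datum one pads (A1)-balanced ghost quadruples
`ch Z₁ + ch Z₂ = ch Z₃ + ch Z₄` of distinct height-14 cells (e.g. first letters `(7;7,0),(7;−7,0)` vs `(7;0,7),(7;0,−7)`) with zero letter modules —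
still positive, passing, IN SCOPE — and breaks `HallUp` (a ghost `P`-cell dead to every `N`-cell), the PP ∕ leg rows, RULE D, and (by relabelled
frame padding) the geometric budget.  So a LAW-FREE scope-guarded 2b for any letter-reading row is refutable GIVEN one 2a datum — MEMO-177's F6 one
level up — and would be `¬ 2a` in costume; only the class rows are honest law-free; the letter-reading rows need a PRESENTATION PIN in the guard.
v2 registered them under the REALISATION TIE `δ₀.Realisable` ((R3) of v42.1 §42.3: `∃ C, TopChernFourLocalisation C ∧ δ₀.Realises C`; non-vacuity =
item stmt-HodgeConjecture-19780 `Ring2.SemiregularRepresentatives.ChernCharacterOnBetti`, cf. `SplitBlockDatum₀.Realisable.nonempty`; NOT (R1) the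
twist-normalised realisation — dead, hazard (f5); NOT (R2) `RealisesUpToScale`), and hsem-3 memo-213 (`Memo213RealisableBench.lean` 16348300a1b04002,
kernel, 0 sorry) CERTIFIED the tie as a pin: (B1) ghost letters FAIL the tie for EVERY C, unconditionally (`not_realisable_padZero`); (B2) relabelling at
fixed C survives only class-preserving bijections — in a SEPARATING frame only the identity, same shadow; (B3) through `∃ C` the tie is rescale ∕ dilation
covariant and the dilated shell is excluded exactly by `ScopeRows 14` (scope is load-bearing, as designed); (B4) exhaustive modulo LEMMA U: in scope
`|q| = 1` ⇒ identity, or `q = −1` on all-level-zero shells — the one residual, closed for every row by module pinning given `OriginSeparating` (hsem-2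
memo-182; c5c8 K2′; memo-214 (K2′) ×2; `OriginSeparating` now PROVED — `OriginSep.originSeparating_holds`, below) — VERDICT R19.888: F8 = memo-212 R2 MET,
the rows STAND.
**v3 ((P′) R19.889 (i)) — THE GUARD OF RECORD IS THE C-FREE ORIGIN PIN** `originLaw E₀ ψ₀ δ₀ := ∃ h1 : E₀.dim = 1, δ₀.PinnedTo (originModel E₀ h1 ψ₀)`
(v42.3 `SeedCheckerSplitBlockLetterBundle.lean` 845643cddb00db48, c5c8-1 g55: every letter module IS, up to isomorphism, the CONSTRUCTED origin letter
bundle `letterBundle (originLine E₀ h1) ψ₀ Z` of its own cell — memo-212 R3 with no parameter left; C-FREE: no `ChernCharacterBetti`, no LEMMA U, no 19780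
on any path): (K1) `not_originLaw_padZero` — ghost letters fail the pin UNCONDITIONALLY (a fresh letter is the zero object vs `PinnedTo.not_isZero_P ∕ _N`;
in the tree as `originLaw.not_isZero_P ∕ _N`; c5c8's bench `LabelBench.lean` 4836f319673a0a77); (K2′) a relabelling pinned before and after FIXES EVERY
CELL, given `OriginSeparating` (hsem-3 memo-214 `Memo214OriginPinBench.lean` 2c33becc2d00230f: `shadow_relabel_eq_of_originLaw`,
`rows_relabel_iff_of_originLaw`).  The four letter-reading row stubs therefore take `originLaw E₀ ψ₀ δ →` in the tie's old slot, and **the 19780 price is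
OFF the kill side** ((F-B′); officer G8 ∕ J q5: vacuity locus — none on the kill side).  `OriginSeparating : Prop` (NS(E₀ × E₀) for a CM curve with
`ψ₀² = −1`: the classes `u + v, e₁, e₂` have Gram matrix `diag(2, −2, −2)`; sheaf8-1's item (P′)(iii)) was the ONE typed hypothesis of the relabel-invariance,
not of any stub — **NOW PROVED UNCONDITIONALLY: `OriginSep.originSeparating_holds : SplitBlock.OriginSeparating`** (hsemireg-sheaf8-1 g10
`OriginSeparatingReduction.lean` v2.0 0e2215361dd7051c @392b6835d6f4 → v2.1 9f3f39ac5dfbc894 @27a19ffe0b36, 0 sorry, std axioms — RESULT-4 hsem l.14009;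
officer AUDIT 139 PLATE #118 PASS, 89∕89 std, identity probe: the type IS v42.3's decl; director R19.907 (O′)(i)–(ii): (P′)(iii) DISCHARGED — the origin pin
NAMES ITS CELLS with no typed hypothesis, v42.3's relabel-kill `PinnedTo.cell_eq_P ∕ _N` is hypothesis-free); cited here, NOT imported (R19.907: no build
dependency on the skeleton).  `δ₀.Realisable` stays in v42.1 as the off-path C-sentence
(`SplitBlockDatum₀.Realisable`; v42.3 `LetterModel.RealisedThrough`), cited here, registered nowhere.  **REACH ((P″) R19.894 (R-b); hsem-3 memo-214
(f7))**: the pin fixes each letter's ISOMORPHISM class, so kills under `lawSigma S := S ∧ originLaw ∧ KNI` bear on UNDECORATED (origin-pinned)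
presentations only; Pic⁰-decorated presentations (`letterBundle 𝒪(o) ψ₀ Z ⊗ Q_Z`, translates, uniform twists) are OUT OF REACH pending the open
normalisation `ReachModDec` (memo-214: stated, not asserted, no proof known) or a `Passes (t_x^* δ) ↔ Passes δ` lemma (none in the tree); the on-path
`stub_rung2a : Rung2a₀ 14` is law-free and unaffected.
**v4 ((R-a) R19.894 ∕ R19.900 ∕ R19.901 — THE GUARD OF RECORD IS THE `Pic⁰`-DECORATED ORIGIN PIN** `originPicZeroLaw := decLaw picZero` (v42.4
`SeedCheckerSplitBlockPicZeroPin.lean` 65704d1ec475419c, c5c8-1 g55; hsem-3 memo-214 §D): `originPicZeroLaw E₀ ψ₀ δ ↔ ∃ h1 : E₀.dim = 1, DecPinnedTo (picZero E₀)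
δ.toSplitBlockCore₀ (originModel E₀ h1 ψ₀)` — every letter module is, up to isomorphism, `letterBundle (originLine E₀ h1) ψ₀ Z ⊗ Q` for ITS OWN cell `Z` and some
`Q` with `HasRank Q 1 ∧ AbelianVarieties.IsHomogeneous (pad4Anchor E₀) Q` (`Pic⁰(S⁴)`: Mukai homogeneity, Mumford §8–§9; `𝒪` homogeneous, so `originLaw ⇒
originPicZeroLaw` — `originPicZeroLaw_of_originLaw`).  The acceptance tests persist: (K1) `not_originPicZeroLaw_padZero` — ghost letters fail OUTRIGHT; (K2)
`shadow_relabel_eq_of_originPicZeroLaw ∕ rows_relabel_iff_of_originPicZeroLaw` — a relabelling decorated-pinned before and after fixes every cell, modulo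
`OriginDecSeparating` — PROVED: `OriginSep.originDecSeparating_holds` (sheaf8-1 g10 v2.1 9f3f39ac5dfbc894 §4, via v42.5's `originDecSeparating_of_invariant`;
hsem l.14033; officer AUDIT 140 PLATE #119 PASS; cited, not imported) — so (K2) holds UNCONDITIONALLY; (R1) `rankOneLaw_of_originPicZeroLaw`.
WHY THE ROWS SURVIVE THE WIDENING ((f7-4), booked R19.900): rows 5 ∕ 6 ∕ 6′ and the class rows read `Dsh.shadow` only — NS-level, decoration-blind (`c₁(Q) = 0`
for `Q ∈ Pic⁰`); the budget row bounds `ext2` of the presentation's OWN cokernel above (direction check (T-g3′)(c), case 1); the one decoration-sensitive sentence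
is the LAW `kniLaw` (an attained ceiling), which sits in the GUARD `lawSigmaPic`, costing reach, not soundness.  (R-a) EXPOSURE, stated once for rows 5 ∕ 6 ∕ 6′
(planner's note, not a pen claim): the rows' PROOFS go through the ZERO PATTERN of the block between DECORATED letters, `Hom(L_P ⊗ Q_P, L_N ⊗ Q_N) =
H⁰(L_N ⊗ L_P^∨ ⊗ Q_N ⊗ Q_P^∨)`; for a difference class NON-DEGENERATE in every factor this is decoration-blind (`L ⊗ Q ≅ t_x^* L`, Mumford §8 ∕ §16), for a
factor class that is ISOTROPIC NON-ZERO (`c_f² = 0`, `c_f ≠ 0`; on the sublattice `⟨H, D₁, D₂⟩` of `NS(E₀²)` at `N = 2`: `a² = x² + y²`) `H⁰` depends on the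
`Pic⁰`-component (exactly the members trivial on `K(L)⁰` have cohomology) — so a weakly-dead pair with an isotropic factor difference is where a decorated
presentation could un-kill an entry; if an in-scope design has one, THAT row falls back to v3's guard (the v3 records are kept verbatim below and do not
depend on the widening) — a Leg-B ∕ pen check, finite over the height-14 alphabet, not a g3 item.  The four sorried row stubs take `originPicZeroLaw E₀ ψ₀ δ →`
in the pin's slot (statement diff v3 → v4 = exactly that one token each); §3–§5 keep every v3 name with its v3 statement, now DERIVED, and add the `…Pic…`
records ∕ kills ∕ transports.

## Disproof ∕ negatives used
No `Cruxes/BlochSeedDiscOne/Disproof.lean` and no `Theorems/BlochSeedDiscOne/Negative/` exist (2026-08-31, re-checked at the g2 and g3 touches).  `ledger negatives --problem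
HodgeConjecture` (6 entries: SparseFermat, MilnorK, So7 theta, MirrorBrane, DerivedTorelliFermat, ELineTransport) — none bears on this route.  Dead
lines honoured: g0's v1 shape (2a consumed only `SeedCheck` — costume; untied 2b ⟺ `SPlus → ¬2a`, `letterShadowOn_iff`) — R19.841 (A); `Λ :=
DatumLaw.trivial` on line #2 — R19.862∕865; law `:=` row — R19.867 (c); (R1) twist-normalised realisation — (f5); unguarded 2b — MEMO-177 F6∕F7;
`Nonex 14 199 8` REFUTED as typed (`RotatedPairB136.not_nonex_fourteen`) — the v42 room carries `HallUp`, LAW PP, the leg row and the budget, all of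
which B136 fails or is priced by; (g2) a Π-form α1 stub `∀ W, …` — (W′)∕(W″), memo-181; the (W″) feed through `alpha1_of_le_lawStaticTied` under the
pinned σ-law — officer AUDIT 133 (F1), kernel; (F2)'s unguarded `Alpha1Row W` as hypothesis of record — (P′)(i).

## References
[cite: Fulton1998, §14.1, Thm. 14.4, Example 12.1.7, Example 14.4.12] [cite: FultonLazarsfeld1981] [cite: Bloch1972Semiregularity, Thm. (7.4)]
[cite: BuchweitzFlenner2003, Thm. 5.2] [cite: MumfordAV1970, §16] — hsemireg-c5c8-1 g54 memo `SEED-CHECKER-C5C8-c5c8-1-g54.md` §2; hsem-2 MEMO-177;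
semihom-1 g66 ∕ g67 ∕ g68 (`KunnethNoInterference.lean`, adapter b8460116ae47a551, layer B 180e709cc9cece30, memo a8fe89942c67b19b); negation g26 ∕ gs-eng-2
g67 (PatternedPorteous THEOREM A∕B); c5c8-1 g55 (v42.3 845643cddb00db48, `LabelBench.lean` 4836f319673a0a77); sheaf8-1 g10 (`SplitBlockClassRows.lean`);
hsem-3 memo-212 ∕ 213 ∕ 214 (benches c199005e96f7d9b0, 16348300a1b04002, 2c33becc2d00230f); hsem-2 memo-177 ∕ 180 ∕ 181 ∕ 182; officer AUDIT 123 ∕ 127 ∕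
129 ∕ 131 ∕ 133 ∕ 135 ∕ 136 ∕ 137 (PLATE #112 of v42.4); sheaf8-1 g10 RESULT-2 (memo 3c22f0d2c0a5e783, `DoorSPhiShellTwo.lean` 578157cf42c8e63e) + director (Φ′) R19.898; c5c8-1 g55 RESULT-4
(`PPFlip.lean` 9a48245328a40039), RESULT-5 (v42.4 65704d1ec475419c, (f7-4)), RESULT-6 (v42.5 8568e1b2271e8e02, not imported); negation g26 NOTE-4 (f7-4);
sheaf8-1 g10 RESULT-4 ∕ RESULT-5 (`OriginSeparatingReduction.lean` v2.0 0e2215361dd7051c @392b6835d6f4 ∕ v2.1 9f3f39ac5dfbc894 @27a19ffe0b36: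
`OriginSep.originSeparating_holds`, `OriginSep.originDecSeparating_holds` — cited, NOT imported) + officer AUDIT 139 PLATE #118 ∕ AUDIT 140 PLATE #119 + director
R19.907 (O′) ∕ R19.909 ∕ R19.910 (O″); [cite: MumfordAV1970, §8, §16]
(`L ⊗ Q ≅ t_x^* L` for non-degenerate `L`, `Q ∈ Pic⁰`; index theorem) for the (R-a) exposure note.  No `instance`, no notation, no `axiom`, no `set_option allowUnsafeReducibility`;
`sorry` exactly in the FIVE sorried `stub_*` (`stub_rung2a`, `stub_hallRow`, `stub_ppRow`, `stub_legRow`, `stub_extBudget`); `stub_classRows` is a theorem by citation.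
-/

noncomputable section

-- single-problem summit (Problem = Summit): the mandated namespace repeats `HodgeConjecture`.
set_option linter.dupNamespace false
set_option autoImplicit false

open CategoryTheory AlgebraicGeometry
open Literature.AlgebraicGeometry Literature.AlgebraicGeometry.Motives Literature.AlgebraicGeometry.HodgeTheory
open Literature.AlgebraicTopology.SingularHomology

namespace Summit.HodgeConjecture.HodgeConjecture.Cruxes.BlochSeedDiscOne.SplitBlock

open Summit.HodgeConjecture.HodgeConjecture.Cruxes.BlochSeedDiscOne.Anchor
open Summit.Ventures.HSemireg Summit.Ventures.HSemireg.Pad4Tower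
open Summit.HodgeConjecture.HodgeConjecture.Cruxes.BlochSeedDiscOne.SeedChecker
open Summit.HodgeConjecture.HodgeConjecture.Cruxes.BlochSeedDiscOne.SeedChecker.SplitBlock

/-! ## §1 ON PATH — RUNG 2a₀ (C-free) and the composition concluding the crux BY NAME -/

section OnPath

/-- **STUB — RUNG 2a₀ AT HEIGHT 14, C-FREE (R19.845 (O1); size L; research).**  On SOME CM anchor `(E₀, ψ₀)` (`dim E₀ = 1`, `ψ₀ ≫ ψ₀ = −1`)
there is a C-free split-block datum `δ₀ : SplitBlockDatum₀ E₀ ψ₀` with POSITIVE shell multiplicities which PASSES (its rank-4 class design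
`Dsh.padApexUp 0 k` passes the seed checker on the presented subscheme for some `q`, and the presented subscheme is the zero scheme of the section
of `Q`) and whose shell shadow is in READING-1 normal form on the height-14 alphabet (`ScopeRows 14`).
**COSTUME DECLARED (officer AUDIT 123, hsem l.13551; R19.864): the on-path content of `Rung2a₀` is `Passes.1` = `CoreCert` = the crux at one CM
anchor in json clothing (v41 FLAG); this line's registered use is the kill path, which refutes split-block PRESENTATIONS only — never
`¬ BlochSeedDiscOne`, never the crux.**
WHY IT MIGHT FAIL: every design of record is class-dead or fails positivity ∕ Hall (`HallB136.not_hallUp`, gs-eng-2 CE₃∕CE₄); the object half —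
a regular section with `Z(s)` integral AND Bloch-semiregular in the 8-fold (`IsBlochSemiregular i 8 4`, target `H⁵(Ω³)` of dimension `56² = 3136`)
for a charged `c₄` — is untested at `n = 4`; (σ) needs the top-Chern localisation for an honest `C` or a direct support computation.
[cite: Fulton1998, §14.1] [cite: Bloch1972Semiregularity, Thm. (7.4)] -/
theorem stub_rung2a : Rung2a₀ 14 := by
  sorry

/-- **THE COMPOSITION — the crux BY NAME** (type LITERALLY the route decl; `sorry` only through `stub_rung2a`).
**COSTUME DECLARED (officer AUDIT 123, hsem l.13551; R19.864): the on-path content of `Rung2a₀` is `Passes.1` = `CoreCert` = the crux at one CM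
anchor in json clothing (v41 FLAG); this line's registered use is the kill path, which refutes split-block PRESENTATIONS only — never
`¬ BlochSeedDiscOne`, never the crux.** -/
theorem BlochSeedDiscOne_of : Summit.HodgeConjecture.HodgeConjecture.Theses.EightfoldBlochSeeds.BlochSeedDiscOne :=
  blochSeedDiscOne_of_rung2a₀ stub_rung2a

/-- the same composition in hypothesis form (sorry-free): the stub's STATEMENT implies the crux by name. -/
theorem BlochSeedDiscOne_of_rung2a (h : Rung2a₀ 14) :
    Summit.HodgeConjecture.HodgeConjecture.Theses.EightfoldBlochSeeds.BlochSeedDiscOne :=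
  blochSeedDiscOne_of_rung2a₀ h

/-- … and under ANY law: a law-abiding 2a₀ datum is a 2a₀ datum (v42.1 `Rung2a₀Under.rung2a₀`). -/
theorem BlochSeedDiscOne_of_rung2aUnder {Λ : DatumLaw} (h : Rung2a₀Under Λ 14) :
    Summit.HodgeConjecture.HodgeConjecture.Theses.EightfoldBlochSeeds.BlochSeedDiscOne :=
  blochSeedDiscOne_of_rung2a₀ h.rung2a₀

end OnPath

/-! ## §2 OFF PATH — the ROW STUBS of RUNG 2b₀ (guard: CM anchor → `Pic⁰`-decorated origin pin → Positive (F7) → Passes → ScopeRows 14 (F6) → row of the shadow)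

Every signature is spelled over importable declarations only (skeleton-import hygiene): a prover restates it WITHOUT importing this file and lands
`theorem stub_… : <signature>` with `ledger propose … --supports stmt-HodgeConjecture-18881` (as sheaf8-1 g10 did for `stub_classRows`, cited below).
The three LETTER rows `stub_hallRow ∕ stub_ppRow ∕ stub_legRow` are DEFINITIONALLY `Rung2b₀Under originPicZeroLaw 14 Row` (`§3` records the repackagings,
and DERIVES v3's `Rung2b₀Under originLaw 14 Row` forms by v42.4's `rung2b₀Under_originLaw_of_originPicZeroLaw`);
`stub_extBudget` has the same guard but its conclusion ALSO reads the datum's own sheaf `δ.S.X₃`, so it is not `Rung2b₀Under Λ 14 Row` for a row of the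
shadow alone (nit n1, hsem-2 memo-180 — v2's «each is definitionally …» over-claimed for it); `stub_classRows` keeps its registered type verbatim, the
unused `ScopeRows 14` antecedent included (nit n2), and is a THEOREM BY CITATION.  **Guard token of record on the four sorried rows (v4, (R-a) R19.900 ∕
R19.901): `originPicZeroLaw E₀ ψ₀ δ`, in the position v3's `originLaw E₀ ψ₀ δ` ((P′) R19.889 (i)) and v2's `δ.Realisable` had — statement diff v3 → v4 =
exactly this one token per stub; all four re-guarded (direction check (T-g3′)(c) case 1 for `stub_extBudget`).** -/

section RowStubs

/-- **THE CLASS ROWS, LAW-FREE — CLOSED BY CITATION of `ClassRows.stub_classRows`** (touch item (1), R19.888; hsemireg-sheaf8-1 g10,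
`Cruxes/BlochSeedDiscOne/SplitBlockClassRows.lean`, sorry-free, std axioms, BUILT; officer AUDIT 129 PLATE #104 PASS).  The registered name and signature
persist VERBATIM (so `skeleton check` may still list the name — it carries no `sorry`); the `ScopeRows 14` antecedent is unused (nit n2: kept, it is the
registered type; `ClassRows.classRows_of_passes` is the minimal form «positive shell + `Passes`»).  STATEMENT (size M; kernel dictionary): for every CM
anchor and every C-free split-block datum with positive shell which passes: the shell SHADOW is (A1)-clean in the letter model, has `μ ≠ 0`, and
rank `≥ 4`.  Route (as proved there): `Passes.1` gives C0 of `Dsh.padApexUp 0 k` (`ClassData` = `Clean ∧ mu ≠ 0 ∧ rank = 4 ∧ Positive`); `padApexUp_mu`, `padApexUp_rank`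
(`rank Dsh = 4 + k`), cleanness of `Dsh` from that of the padded design (the apex cell `(0;0,0)⁴` has class `1`); then the json ↔ letter-model
dictionary under `Design.shadow` (`cellCoef_shadowCell`; `Finset.toList` sums; `Int.toNat` faithful by positivity) transports `Clean ↦ A1`,
`mu ↦ mu`, `rank ↦ rank` (`shadow_A1_of_clean`, `shadow_mu`, `shadow_rank`; the feared `Clean`∕`A1` convention mismatch did not materialise:
`Clean → A1` holds through the symbol dictionary `liftSym`). [cite: Fulton1998, Example 3.2.3] -/
theorem stub_classRows :
    ∀ (E₀ : AbelianVariety ℂ) (ψ₀ : E₀ ⟶ E₀), E₀.dim = 1 → ψ₀ ≫ ψ₀ = -(1 • 𝟙 E₀) →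
      ∀ δ : SplitBlockDatum₀ E₀ ψ₀, δ.Dsh.Positive → δ.Passes → ScopeRows 14 δ.Dsh.shadow →
        δ.Dsh.shadow.A1 ∧ δ.Dsh.shadow.mu ≠ 0 ∧ 4 ≤ δ.Dsh.shadow.rank :=
  ClassRows.stub_classRows

/-- **STUB — THE HALL ROW [row 5] UNDER THE `Pic⁰`-DECORATED ORIGIN PIN ((R-a) R19.894 ∕ R19.900 ∕ R19.901; v3: the origin pin (P′) R19.889 (i); size L;
sheaf-level König–Hall, theorem-grade).**  For every CM anchor and every C-free datum whose letter modules ARE, up to isomorphism, the origin letter bundles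
of their own cells TWISTED BY HOMOGENEOUS RANK-ONE MODULES (`originPicZeroLaw E₀ ψ₀ δ`, v42.4 — the C-FREE presentation pin modulo `Pic⁰(S⁴)`, in the slot
where v3 had `originLaw E₀ ψ₀ δ` and v2 the realisation tie `δ.Realisable`; no Chern character theory and no 19780 on this path), positive, passing,
in scope: the shadow satisfies `HallB136.HallUp` (for every set `U` of `P`-entries, `Σ_U m_P ≤ Σ n_N` over the `N`-entries weakly live above `U`).
Route: pinned letters ⟹ `LetterHomVanishing` (Künneth of `H⁰` on `S⁴ = (E₀ × E₀)⁴`: a dead difference letter has no sections, Fulton–Lazarsfeld) ⟹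
`DeadEntriesVanish` (v42.1) ⟹ the block map `⊕_U L_P^{m_P} → 𝓝` factors through the weakly-live `N`-summands; `S` short exact ⟹ it is a mono of
vector bundles ⟹ rank count, decorated-pinned letters having rank exactly `1` (`rankOneLaw_of_originPicZeroLaw`).  WHY IT MIGHT FAIL: the mono is of
sheaves, the count needs generic rank on the INTEGRAL `S⁴` and `rank = 1` letters — both come only through the pin (F8: ghost letters kill the unpinned row;
`not_originPicZeroLaw_padZero` ∕ `DecPinnedTo.not_isZero_P` exclude them); (R-a) exposure: the zero pattern between DECORATED letters is NS-decided only
where the difference class is non-degenerate in every factor (`L ⊗ Q ≅ t_x^* L`); an isotropic non-zero factor difference (`a² = x² + y²` on `⟨H, D₁, D₂⟩`)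
makes `H⁰` depend on the `Pic⁰`-component — a decorated in-scope presentation un-killing such an entry moves THIS row back to v3's guard (v3 record kept
below), not the crux; a passing seed with an in-scope decorated-pinned presentation violating Hall kills THIS stub (a Leg-B lead), not the crux.  REACH
((R-a)): origin-pinned presentations UP TO `Pic⁰`-DECORATION.
[cite: Fulton1998, Thm. 14.4 and Example 12.1.7] [cite: FultonLazarsfeld1981] [cite: MumfordAV1970, §8, §16] -/
theorem stub_hallRow :
    ∀ (E₀ : AbelianVariety ℂ) (ψ₀ : E₀ ⟶ E₀), E₀.dim = 1 → ψ₀ ≫ ψ₀ = -(1 • 𝟙 E₀) →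
      ∀ δ : SplitBlockDatum₀ E₀ ψ₀, originPicZeroLaw E₀ ψ₀ δ → δ.Dsh.Positive → δ.Passes → ScopeRows 14 δ.Dsh.shadow →
        HallB136.HallUp δ.Dsh.shadow := by
  sorry

/-- **STUB — LAW PP [row 6] UNDER THE `Pic⁰`-DECORATED ORIGIN PIN ((R-a); v3: (P′); size M–L; PatternedPorteous THEOREM A (i): pen ×1 (negation g26 v1.2 §4bis) +
independent numerics ×2 (gs-eng-2 g67, R19.875); kernel port open).**  Same guard (`originPicZeroLaw E₀ ψ₀ δ` in the pin's slot); conclusion `lawPP δ.Dsh.shadow` = `PatternedPorteous.PPClean weakB`: for every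
CLOSED receiver set `R` of `N`-cells (unions of weak-arrow neighbourhoods) with full sender set `T_R ≠ ∅`: `m_P(T_R) ≤ m_N(R)` and (surplus `≥ 8` or
every Chern monomial of `c(N[R] − P[T_R])` has degree `≤` the surplus) — Whitney ∕ Porteous: NECESSARY for local freeness of the cokernel of ANY
display with that zero pattern (here `𝓔 = δ.S.X₃` IS a vector bundle, `isVectorBundle₃`).  Needs the pin twice: zero pattern (`DeadEntriesVanish`)
and `c(L_Z) = c(Z)` — under the decorated pin: the zero pattern between DECORATED-PINNED letters ((R-a) exposure as for row 5: NS-decided off isotropic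
factor differences), and the decorated letter's class IS its cell's class (`c₁(Q) = 0` for `Q ∈ Pic⁰`; the origin letter's class by the construction of
`letterBundle`, pen).  WHY IT MIGHT FAIL: the pen's (i) is stated for displays of DECORATED letter bundles with the weak pattern; a
subtlety in «closed receiver set» vs the actual image filtration would move the row (then LAW PP is re-cut, R19.859 accounting), not the crux; the
level-zero sign flip `(x, y) ↦ (−x, −y)` (memo-213 (B4) residual) is closed on the guard side by module pinning given `OriginSeparating` (PROVED:
`OriginSep.originSeparating_holds`, sheaf8-1 g10 `OriginSeparatingReduction.lean` v2.1 9f3f39ac5dfbc894; decorated twin `originDecSeparating_holds`), and on the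
conclusion side `lawPP` IS FLIP-INVARIANT (c5c8-1 g55 RESULT-4, hsem l.13912: json 50∕50 on the PP census; kernel `Critic.PPFlip` probe `PPFlip.lean`
9a48245328a40039, `weakB_flip` ∕ `ppClean_flip_bus` by `decide` per design; pen for every design) — no g3 item arises from LAW PP.  REACH ((R-a)):
origin-pinned presentations UP TO `Pic⁰`-DECORATION (rows 5 ∕ 6 ∕ 6′ type-safe and pen-safe under `originPicZeroLaw`: negation g26 NOTE-4, hsem l.13954).
[cite: Fulton1998, Thm. 14.4 (b), Example 14.4.12] -/
theorem stub_ppRow :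
    ∀ (E₀ : AbelianVariety ℂ) (ψ₀ : E₀ ⟶ E₀), E₀.dim = 1 → ψ₀ ≫ ψ₀ = -(1 • 𝟙 E₀) →
      ∀ δ : SplitBlockDatum₀ E₀ ψ₀, originPicZeroLaw E₀ ψ₀ δ → δ.Dsh.Positive → δ.Passes → ScopeRows 14 δ.Dsh.shadow →
        lawPP δ.Dsh.shadow := by
  sorry

/-- **STUB — THE LEG ROW [row 6′] UNDER THE `Pic⁰`-DECORATED ORIGIN PIN ((R-a); v3: (P′); size L; FLAGGED R19.859: theorem-grade on uniform-leg and leg-free-star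
column sets, conditional on Q1 (one-column: settled pen ×1 + machine ×2); multi-column (MS) OPEN as a theorem, 7 252 + 1 000 supporting instances, 0 against;
R19.901 (acc): closable by CITATION only when a kernel `q1` lands — c5c8-1 g55's typed-not-proved `TheoremQ1` shell `SeedCheckerSplitBlockQ1Shell.lean`,
`legRow_of_ppRow_of_q1`, NOT a hypothesis of any record here).**
Same guard; conclusion `PortHallLeg.HallPlusLegUp δ.Dsh.shadow`: Hall's count with the LEG SURPLUS — for `S ⊆ P`-entries of positive mass, `T` the
weakly-live `N`-entries above `S`, and any `d ≤ 8` not exceeding the leg dimension `pairDim` of every weakly-live pair in `S × T`: `Σ_S m + d ≤ Σ_T n`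
(positivity of the live difference letters, Fulton–Lazarsfeld, refines König–Hall by the least leg dimension met).  WHY IT MIGHT FAIL: (MS) — on a
MIXED multi-column set the surplus may be smaller than the least pairwise leg dimension; a counterexample display re-cuts row 6′ (R19.859), and an
origin-pinned (up to `Pic⁰`) in-scope presentation of a passing seed violating it kills THIS stub, not the crux.  Same guard (`originPicZeroLaw E₀ ψ₀ δ` in the
pin's slot; positivity of the live difference letters is a statement about DECORATED-PINNED letters — (R-a) exposure as for row 5 off isotropic factor
differences).  REACH ((R-a)): origin-pinned presentations UP TO `Pic⁰`-DECORATION.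
[cite: FultonLazarsfeld1981] [cite: Fulton1998, Example 12.1.7] -/
theorem stub_legRow :
    ∀ (E₀ : AbelianVariety ℂ) (ψ₀ : E₀ ⟶ E₀), E₀.dim = 1 → ψ₀ ≫ ψ₀ = -(1 • 𝟙 E₀) →
      ∀ δ : SplitBlockDatum₀ E₀ ψ₀, originPicZeroLaw E₀ ψ₀ δ → δ.Dsh.Positive → δ.Passes → ScopeRows 14 δ.Dsh.shadow →
        PortHallLeg.HallPlusLegUp δ.Dsh.shadow := by
  sorry

/-- **STUB — THE GEOMETRIC BUDGET ROW (8) UNDER THE `Pic⁰`-DECORATED ORIGIN PIN ((R-a); v3: (P′); size L; hsemireg-semihom-1 g66 THEOREM A′ ∕ C, PEN; a STUB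
TARGET, never a law — R19.865 (d)).**  DIRECTION CHECK ((T-g3′)(c) R19.901, case 1 — re-guarded WITH the three letter rows): `KunnethNoInterference.lean`
47e2ff3c1f7b1e52 l.120–121 `def ExtBudgetRow (π : ℤ) (D' : Design) (𝓔 …) : Prop := (ext2 𝓔 : ℤ) + 28 * (D'.rank - 4) + π ≤ 3136` — `δ.S.X₃` enters ONLY
through `ext2`, bounded ABOVE by shadow data («r(X₃) ≤ f(shadow)»); the attained-ceiling sentence `sigmaH D' ≤ (ext2 𝓔 : ℤ)` (l.115–116) is the LAW
`KunnethNoInterference` = `lawKNI` (guard side; c5c8-1 g55 RESULT-5∕-6 (f7-4)); the row is PER DATUM — it reads the decorated presentation's OWN cokernel.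
Same guard (`originPicZeroLaw E₀ ψ₀ δ` in the pin's slot); conclusion `KunnethNoInterference.ExtBudgetRow 0 δ.Dsh.shadow δ.S.X₃`
(= the adapter's `extBudgetLaw 0 E₀ ψ₀ δ`; it reads the datum's OWN SHEAF `δ.S.X₃`, not only the shadow — nit n1), i.e.
`dim_ℂ Ext²(𝓔,𝓔) + 28·(rank − 4) + 0 ≤ 3136 = h^{3,5}(S⁴)` for the block's cokernel `𝓔 = δ.S.X₃` (`28 = h^{0,2}(S⁴)` prices each frame summand;
`rank` of the shadow `= 4 + k` by `stub_classRows`' dictionary).  What Bloch-semiregularity of the seed `Z(s)` (C7, injectivity of the semiregularity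
map into `H⁵(Ω³)`, `dim = 56² = 3136`) yields through the frame sequence `0 → 𝒪^k → 𝓔 → Q → 0`.  The letter clause of row 8 follows by a FLOOR law:
`KunnethNoInterference` (8σ) or LEMMA Δ's `PhiAllPlusFloor` (8♮⁺) — `§4`.  WHY IT MIGHT FAIL: the comparison `Ext²(𝓔,𝓔) ↪ obstruction space of
Z ⊂ S⁴` may lose the `Ext²(Q, 𝒪^k)`-type cross terms (then the rider `π` or the `28·(rank − 4)` price is re-cut by the semihom lineage); scope is
load-bearing (frame padding `𝓔 ⊕ 𝒪^m` breaks the row and exits the height-14 alphabet only for PINNED letters — F8, hence the pin; a ghost frame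
summand relabelled into the alphabet is excluded by `not_originPicZeroLaw_padZero`).  REACH ((R-a)): origin-pinned presentations UP TO `Pic⁰`-DECORATION.
[cite: Bloch1972Semiregularity, Thm. (7.4)] [cite: BuchweitzFlenner2003, Thm. 5.2] [cite: MumfordAV1970, §16] -/
theorem stub_extBudget :
    ∀ (E₀ : AbelianVariety ℂ) (ψ₀ : E₀ ⟶ E₀), E₀.dim = 1 → ψ₀ ≫ ψ₀ = -(1 • 𝟙 E₀) →
      ∀ δ : SplitBlockDatum₀ E₀ ψ₀, originPicZeroLaw E₀ ψ₀ δ → δ.Dsh.Positive → δ.Passes → ScopeRows 14 δ.Dsh.shadow →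
        KunnethNoInterference.ExtBudgetRow 0 δ.Dsh.shadow δ.S.X₃ := by
  sorry

end RowStubs

/-! ## §3 The law slots (local names for READING ONLY — never used in a stub signature) and the repackagings `stub = Rung2b₀Under Λ 14 Row`

CONJUNCT ORDER OF RECORD ((P′)(iv)): `lawSigma S := S ∧ originLaw ∧ KNI`, `lawNatural S := S ∧ originLaw ∧ LEMMA Δ floor`, `lawPinned S := S ∧ originLaw`
— projections `h.1 : S …`, `h.2.1 : originLaw …`, `h.2.2 : floor …`; **v4 ((R-a) R19.900 ∕ R19.901): the DECORATED twins `lawSigmaPic S := S ∧ originPicZeroLaw ∧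
KNI`, `lawNaturalPic S := S ∧ originPicZeroLaw ∧ LEMMA Δ floor`, `lawPinnedPic S := S ∧ originPicZeroLaw` — SAME conjunct order and projections; `lawSigma S ⇒
lawSigmaPic S` pointwise (`originPicZeroLaw_of_originLaw`), so a RECORD under `lawSigmaPic S` is the STRONGER one and implies the v3 record
(`rung2b₀Under_sigma_originLaw_of_originPicZeroLaw S lawKNI`, v42.4).**  The presentation guard of record on the stubs is v42.4's `originPicZeroLaw` itself (no
local alias; the stubs spell `originPicZeroLaw E₀ ψ₀ δ`; v3 spelled v42.3's `originLaw E₀ ψ₀ δ`); v2's `lawReal := δ.Realisable` is GONE from the law slots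
((P′)(i): the tie stays the off-path C-sentence `SplitBlockDatum₀.Realisable` ∕ `LetterModel.RealisedThrough` of v42.1 ∕ v42.3, cited in the module docstring,
registered nowhere).  Every v3 name of this section keeps its v3 statement (now DERIVED from the stronger stubs); the `…Pic…` ∕ `…_pic` names are v4's. -/

section Laws

/-- the named law of (8σ) as a datum law (R19.847 (2): `σ_H(shadow) ≤ dim Ext²(𝓔,𝓔)` on (shell shadow, cokernel); = the adapter's `kniLaw`, same body). -/
def lawKNI : DatumLaw := fun _ _ δ => KunnethNoInterference.KunnethNoInterference δ.Dsh.shadow δ.S.X₃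

/-- LEMMA Δ's decoration-free floor as a datum law ((8♮⁺); pen theorem-grade — in the law slot only until it is kernel; = the adapter's `phiAllPlusFloorLaw`). -/
def lawFloor : DatumLaw := fun _ _ δ => KunnethNoInterference.PhiAllPlusFloor δ.Dsh.shadow δ.S.X₃

/-- `lawKNI` ∕ `lawFloor` ARE semihom-1 g67's adapter laws `kniLaw` ∕ `phiAllPlusFloorLaw` (`KunnethNoInterferenceDatumLaw.lean` b8460116ae47a551), pointwise
by `Iff.rfl` — so the adapter's transport lemmas (`budgetClause_sigmaH_of_lawAnd_kniLaw`, `rung2b₀Under_lawAnd_of_left ∕ _right`) apply verbatim. -/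
example {E₀ : AbelianVariety ℂ} {ψ₀ : E₀ ⟶ E₀} (δ : SplitBlockDatum₀ E₀ ψ₀) : lawKNI E₀ ψ₀ δ ↔ KunnethNoInterference.kniLaw E₀ ψ₀ δ := Iff.rfl
example {E₀ : AbelianVariety ℂ} {ψ₀ : E₀ ⟶ E₀} (δ : SplitBlockDatum₀ E₀ ψ₀) :
    lawFloor E₀ ψ₀ δ ↔ KunnethNoInterference.phiAllPlusFloorLaw E₀ ψ₀ δ := Iff.rfl

/-- **the (8σ) law of record over the α1-law parameter `S`** ((P′) R19.889 (i); `S := StaticAlongTW.StaticAlongTW W` by decl name in the selector-fed records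
of §4): **`lawSigma S := S ∧ originLaw ∧ KNI` — CONJUNCT ORDER: `S` first, then the ORIGIN PIN, then the floor** (projections `.1`, `.2.1`, `.2.2`);
R19.865's `lawAnd StaticAlongTW kniLaw` with the origin pin adjoined (v2 adjoined the realisation tie in the same position; (P′) put the pin there). -/
def lawSigma (S : DatumLaw) : DatumLaw := fun E₀ ψ₀ δ => S E₀ ψ₀ δ ∧ originLaw E₀ ψ₀ δ ∧ lawKNI E₀ ψ₀ δ

/-- **the (8♮⁺) law of record over `S`**: `lawNatural S := S ∧ originLaw ∧ LEMMA Δ floor` (same conjunct order). -/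
def lawNatural (S : DatumLaw) : DatumLaw := fun E₀ ψ₀ δ => S E₀ ψ₀ δ ∧ originLaw E₀ ψ₀ δ ∧ lawFloor E₀ ψ₀ δ

/-- the floor-free PINNED law `lawPinned S := S ∧ originLaw` — the guard of an α1 row that lifts to BOTH laws of record (§4 `rung2b₀Under_ruleD_record_of_pinned`);
at `S := StaticAlongTW.StaticAlongTW W` it is the law inside §4's `Alpha1RowPinned W`. -/
def lawPinned (S : DatumLaw) : DatumLaw := fun E₀ ψ₀ δ => S E₀ ψ₀ δ ∧ originLaw E₀ ψ₀ δ

/-- **v4 ((R-a) R19.900 ∕ R19.901): the (8σ) law of record over `S` with the `Pic⁰`-DECORATED origin pin in the pin's conjunct —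
`lawSigmaPic S := S ∧ originPicZeroLaw ∧ KNI`, CONJUNCT ORDER `S`, decorated pin, floor (projections `.1`, `.2.1`, `.2.2`).**  It is LITERALLY the lambda
`fun E₀ ψ₀ δ => S E₀ ψ₀ δ ∧ originPicZeroLaw E₀ ψ₀ δ ∧ lawKNI E₀ ψ₀ δ` that v42.4's `rung2b₀Under_sigma_originLaw_of_originPicZeroLaw S lawKNI` consumes. -/
def lawSigmaPic (S : DatumLaw) : DatumLaw := fun E₀ ψ₀ δ => S E₀ ψ₀ δ ∧ originPicZeroLaw E₀ ψ₀ δ ∧ lawKNI E₀ ψ₀ δ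

/-- v4: the (8♮⁺) decorated twin `lawNaturalPic S := S ∧ originPicZeroLaw ∧ LEMMA Δ floor` (same conjunct order; the (8♮) CURRENCY is dead at shell 2, (Φ′)(ii) —
recorded for symmetry, no kill of record uses it). -/
def lawNaturalPic (S : DatumLaw) : DatumLaw := fun E₀ ψ₀ δ => S E₀ ψ₀ δ ∧ originPicZeroLaw E₀ ψ₀ δ ∧ lawFloor E₀ ψ₀ δ

/-- v4: the floor-free DECORATED-PINNED law `lawPinnedPic S := S ∧ originPicZeroLaw` — at `S := StaticAlongTW.StaticAlongTW W` the HYPOTHESIS SHAPE of the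
decorated α1 row `Rung2b₀Under (lawPinnedPic (StaticAlongTW.StaticAlongTW W)) 14 RuleD` (no new `def : Prop`; `Alpha1RowPinned W` is kept verbatim and FED
from it, §4 `alpha1RowPinned_of_picPinned`); LITERALLY the lambda v42.4's `rung2b₀Under_and_originLaw_of_originPicZeroLaw S` consumes. -/
def lawPinnedPic (S : DatumLaw) : DatumLaw := fun E₀ ψ₀ δ => S E₀ ψ₀ δ ∧ originPicZeroLaw E₀ ψ₀ δ

/-- `lawSigma S` IS the adapter's `lawAnd S (lawAnd originLaw kniLaw)` and `lawNatural S` IS `lawAnd S (lawAnd originLaw phiAllPlusFloorLaw)` (pointwise `Iff.rfl`). -/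
example (S : DatumLaw) {E₀ : AbelianVariety ℂ} {ψ₀ : E₀ ⟶ E₀} (δ : SplitBlockDatum₀ E₀ ψ₀) :
    lawSigma S E₀ ψ₀ δ ↔ KunnethNoInterference.lawAnd S (KunnethNoInterference.lawAnd originLaw KunnethNoInterference.kniLaw) E₀ ψ₀ δ := Iff.rfl
example (S : DatumLaw) {E₀ : AbelianVariety ℂ} {ψ₀ : E₀ ⟶ E₀} (δ : SplitBlockDatum₀ E₀ ψ₀) :
    lawNatural S E₀ ψ₀ δ ↔ KunnethNoInterference.lawAnd S (KunnethNoInterference.lawAnd originLaw KunnethNoInterference.phiAllPlusFloorLaw) E₀ ψ₀ δ :=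
  Iff.rfl

/-- both laws of record imply the pinned law and the origin pin (the `hO` antecedent of §4 ∕ §5). -/
theorem lawPinned_of_lawSigma (S : DatumLaw) : ∀ (E₀ : AbelianVariety ℂ) (ψ₀ : E₀ ⟶ E₀) (δ : SplitBlockDatum₀ E₀ ψ₀),
    lawSigma S E₀ ψ₀ δ → lawPinned S E₀ ψ₀ δ :=
  fun _ _ _ h => ⟨h.1, h.2.1⟩

theorem lawPinned_of_lawNatural (S : DatumLaw) : ∀ (E₀ : AbelianVariety ℂ) (ψ₀ : E₀ ⟶ E₀) (δ : SplitBlockDatum₀ E₀ ψ₀),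
    lawNatural S E₀ ψ₀ δ → lawPinned S E₀ ψ₀ δ :=
  fun _ _ _ h => ⟨h.1, h.2.1⟩

theorem originLaw_of_lawSigma (S : DatumLaw) : ∀ (E₀ : AbelianVariety ℂ) (ψ₀ : E₀ ⟶ E₀) (δ : SplitBlockDatum₀ E₀ ψ₀),
    lawSigma S E₀ ψ₀ δ → originLaw E₀ ψ₀ δ :=
  fun _ _ _ h => h.2.1

theorem originLaw_of_lawNatural (S : DatumLaw) : ∀ (E₀ : AbelianVariety ℂ) (ψ₀ : E₀ ⟶ E₀) (δ : SplitBlockDatum₀ E₀ ψ₀),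
    lawNatural S E₀ ψ₀ δ → originLaw E₀ ψ₀ δ :=
  fun _ _ _ h => h.2.1

/-! ### v4: projections and MONOTONICITY of the decorated twins (`originLaw ⇒ originPicZeroLaw`, v42.4 `originPicZeroLaw_of_originLaw`) -/

theorem lawPinnedPic_of_lawSigmaPic (S : DatumLaw) : ∀ (E₀ : AbelianVariety ℂ) (ψ₀ : E₀ ⟶ E₀) (δ : SplitBlockDatum₀ E₀ ψ₀),
    lawSigmaPic S E₀ ψ₀ δ → lawPinnedPic S E₀ ψ₀ δ :=
  fun _ _ _ h => ⟨h.1, h.2.1⟩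

theorem lawPinnedPic_of_lawNaturalPic (S : DatumLaw) : ∀ (E₀ : AbelianVariety ℂ) (ψ₀ : E₀ ⟶ E₀) (δ : SplitBlockDatum₀ E₀ ψ₀),
    lawNaturalPic S E₀ ψ₀ δ → lawPinnedPic S E₀ ψ₀ δ :=
  fun _ _ _ h => ⟨h.1, h.2.1⟩

theorem originPicZeroLaw_of_lawSigmaPic (S : DatumLaw) : ∀ (E₀ : AbelianVariety ℂ) (ψ₀ : E₀ ⟶ E₀) (δ : SplitBlockDatum₀ E₀ ψ₀),
    lawSigmaPic S E₀ ψ₀ δ → originPicZeroLaw E₀ ψ₀ δ :=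
  fun _ _ _ h => h.2.1

theorem originPicZeroLaw_of_lawNaturalPic (S : DatumLaw) : ∀ (E₀ : AbelianVariety ℂ) (ψ₀ : E₀ ⟶ E₀) (δ : SplitBlockDatum₀ E₀ ψ₀),
    lawNaturalPic S E₀ ψ₀ δ → originPicZeroLaw E₀ ψ₀ δ :=
  fun _ _ _ h => h.2.1

/-- the v3 laws imply their decorated twins pointwise (the decorated GUARD is the weaker guard, hence the STRONGER record). -/
theorem lawSigmaPic_of_lawSigma (S : DatumLaw) : ∀ (E₀ : AbelianVariety ℂ) (ψ₀ : E₀ ⟶ E₀) (δ : SplitBlockDatum₀ E₀ ψ₀),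
    lawSigma S E₀ ψ₀ δ → lawSigmaPic S E₀ ψ₀ δ :=
  fun _ _ _ h => ⟨h.1, originPicZeroLaw_of_originLaw h.2.1, h.2.2⟩

theorem lawNaturalPic_of_lawNatural (S : DatumLaw) : ∀ (E₀ : AbelianVariety ℂ) (ψ₀ : E₀ ⟶ E₀) (δ : SplitBlockDatum₀ E₀ ψ₀),
    lawNatural S E₀ ψ₀ δ → lawNaturalPic S E₀ ψ₀ δ :=
  fun _ _ _ h => ⟨h.1, originPicZeroLaw_of_originLaw h.2.1, h.2.2⟩

theorem lawPinnedPic_of_lawPinned (S : DatumLaw) : ∀ (E₀ : AbelianVariety ℂ) (ψ₀ : E₀ ⟶ E₀) (δ : SplitBlockDatum₀ E₀ ψ₀),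
    lawPinned S E₀ ψ₀ δ → lawPinnedPic S E₀ ψ₀ δ :=
  fun _ _ _ h => ⟨h.1, originPicZeroLaw_of_originLaw h.2⟩

/-- `lawSigmaPic S` IS the adapter's `lawAnd S (lawAnd originPicZeroLaw kniLaw)` (pointwise `Iff.rfl`). -/
example (S : DatumLaw) {E₀ : AbelianVariety ℂ} {ψ₀ : E₀ ⟶ E₀} (δ : SplitBlockDatum₀ E₀ ψ₀) :
    lawSigmaPic S E₀ ψ₀ δ ↔ KunnethNoInterference.lawAnd S (KunnethNoInterference.lawAnd originPicZeroLaw KunnethNoInterference.kniLaw) E₀ ψ₀ δ := Iff.rfl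

/-- the class rows, law-free: `Rung2b₀With 14 (A1 ∧ μ ≠ 0 ∧ 4 ≤ rank)` — sheaf8-1 g10's theorem, CITED (`ClassRows.rung2b₀With_classRows`). -/
theorem rung2b₀With_classRows : Rung2b₀With 14 fun D' => D'.A1 ∧ D'.mu ≠ 0 ∧ 4 ≤ D'.rank :=
  ClassRows.rung2b₀With_classRows

/-- … and under ANY law `Λ` at height 14 (CITED: `ClassRows.rung2b₀Under_classRows`). -/
theorem rung2b₀Under_classRows (Λ : DatumLaw) : Rung2b₀Under Λ 14 fun D' => D'.A1 ∧ D'.mu ≠ 0 ∧ 4 ≤ D'.rank :=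
  ClassRows.rung2b₀Under_classRows Λ 14

/-- **v4: the Hall row IS `Rung2b₀Under originPicZeroLaw 14 HallUp` (definitionally; guard token `originPicZeroLaw`).** -/
theorem rung2b₀Under_hallRow_pic : Rung2b₀Under originPicZeroLaw 14 HallB136.HallUp := stub_hallRow

/-- v3's form, DERIVED (v42.4 `rung2b₀Under_originLaw_of_originPicZeroLaw`): the Hall row under the origin pin `Rung2b₀Under originLaw 14 HallUp`. -/
theorem rung2b₀Under_hallRow : Rung2b₀Under originLaw 14 HallB136.HallUp := rung2b₀Under_originLaw_of_originPicZeroLaw stub_hallRow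

/-- **v4: LAW PP IS `Rung2b₀Under originPicZeroLaw 14 lawPP`.** -/
theorem rung2b₀Under_ppRow_pic : Rung2b₀Under originPicZeroLaw 14 lawPP := stub_ppRow

/-- v3's form, derived: `Rung2b₀Under originLaw 14 lawPP`. -/
theorem rung2b₀Under_ppRow : Rung2b₀Under originLaw 14 lawPP := rung2b₀Under_originLaw_of_originPicZeroLaw stub_ppRow

/-- **v4: the leg row IS `Rung2b₀Under originPicZeroLaw 14 HallPlusLegUp`.** -/
theorem rung2b₀Under_legRow_pic : Rung2b₀Under originPicZeroLaw 14 PortHallLeg.HallPlusLegUp := stub_legRow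

/-- v3's form, derived: `Rung2b₀Under originLaw 14 HallPlusLegUp`. -/
theorem rung2b₀Under_legRow : Rung2b₀Under originLaw 14 PortHallLeg.HallPlusLegUp := rung2b₀Under_originLaw_of_originPicZeroLaw stub_legRow

/-- **v4: the budget row in the adapter's datum-indexed currency: `originPicZeroLaw`-guarded `extBudgetLaw 0`** (nit n1: a row of (shadow, OWN SHEAF)). -/
theorem extBudgetLaw_of_originPicZeroLaw :
    ∀ (E₀ : AbelianVariety ℂ) (ψ₀ : E₀ ⟶ E₀), E₀.dim = 1 → ψ₀ ≫ ψ₀ = -(1 • 𝟙 E₀) →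
      ∀ δ : SplitBlockDatum₀ E₀ ψ₀, originPicZeroLaw E₀ ψ₀ δ → δ.Dsh.Positive → δ.Passes → ScopeRows 14 δ.Dsh.shadow →
        KunnethNoInterference.extBudgetLaw 0 E₀ ψ₀ δ :=
  stub_extBudget

/-- v3's form, derived: the `originLaw`-guarded `extBudgetLaw 0` (`originPicZeroLaw_of_originLaw`). -/
theorem extBudgetLaw_of_originLaw :
    ∀ (E₀ : AbelianVariety ℂ) (ψ₀ : E₀ ⟶ E₀), E₀.dim = 1 → ψ₀ ≫ ψ₀ = -(1 • 𝟙 E₀) →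
      ∀ δ : SplitBlockDatum₀ E₀ ψ₀, originLaw E₀ ψ₀ δ → δ.Dsh.Positive → δ.Passes → ScopeRows 14 δ.Dsh.shadow →
        KunnethNoInterference.extBudgetLaw 0 E₀ ψ₀ δ :=
  fun E₀ ψ₀ hE hψ δ hpin => stub_extBudget E₀ ψ₀ hE hψ δ (originPicZeroLaw_of_originLaw hpin)

end Laws

/-! ## §4 ASSEMBLY (sorry-free given the stubs): the rows of record under any law implying the `Pic⁰`-DECORATED ORIGIN PIN (v4) — hence under any law implying
the ORIGIN PIN (v3, derived) — and a floor; (8σ), (8♮⁺); instances of record over the law parameter `S` under `lawSigmaPic S` (v4) and `lawSigma S` (v3, kept);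
ROW α1 origin-pinned per selector (`Alpha1RowPinned W`, (W‴), KEPT VERBATIM; decorated feed) and the SELECTOR-FED records with `S := StaticAlongTW.StaticAlongTW W` -/

section Assembly

/-- **v4 — RUNG 2b₀ OF RECORD FROM THE (RE-GUARDED, STRONGER) STUBS, law-parametric**: if the law `Λ` implies the `Pic⁰`-DECORATED ORIGIN PIN
`originPicZeroLaw` and the floor `σ(shadow) ≤ dim Ext²(𝓔,𝓔)` on its data, then ROW α1 under `Λ` (a HYPOTHESIS — the `StaticAlongTW` lineage's row, never
registered as `∀ W`) gives `Rung2b₀Lci Λ σ 0` (all eight v42 rows, height 14, rider 0).  (v2 asked `Λ ⟹ δ.Realisable`; (P′) the pin; (R-a) the decorated pin.) -/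
theorem rung2b₀Lci_of_stubs_pic {Λ : DatumLaw} {σ : DepthBoundA4.Design → ℤ}
    (hO : ∀ (E₀ : AbelianVariety ℂ) (ψ₀ : E₀ ⟶ E₀) (δ : SplitBlockDatum₀ E₀ ψ₀), Λ E₀ ψ₀ δ → originPicZeroLaw E₀ ψ₀ δ)
    (hfloor : ∀ (E₀ : AbelianVariety ℂ) (ψ₀ : E₀ ⟶ E₀) (δ : SplitBlockDatum₀ E₀ ψ₀), Λ E₀ ψ₀ δ →
      σ δ.Dsh.shadow ≤ (KunnethNoInterference.ext2 δ.S.X₃ : ℤ))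
    (hα1 : Rung2b₀Under Λ 14 LeggedFloor.RuleD) : Rung2b₀Lci Λ σ 0 := by
  intro E₀ ψ₀ hE hψ δ hΛ hpos hpass hscope
  have hpin : originPicZeroLaw E₀ ψ₀ δ := hO E₀ ψ₀ δ hΛ
  obtain ⟨hA1, hμ, h4⟩ := stub_classRows E₀ ψ₀ hE hψ δ hpos hpass hscope
  exact ⟨hA1, hμ, hα1 E₀ ψ₀ hE hψ δ hΛ hpos hpass hscope, stub_hallRow E₀ ψ₀ hE hψ δ hpin hpos hpass hscope,
    stub_ppRow E₀ ψ₀ hE hψ δ hpin hpos hpass hscope, stub_legRow E₀ ψ₀ hE hψ δ hpin hpos hpass hscope, h4,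
    KunnethNoInterference.budgetClause_of_floor (hfloor E₀ ψ₀ δ hΛ) (stub_extBudget E₀ ψ₀ hE hψ δ hpin hpos hpass hscope)⟩

/-- v3's **RUNG 2b₀ OF RECORD FROM THE STUBS, law-parametric** — statement VERBATIM, now DERIVED: if the law `Λ` implies the ORIGIN PIN `originLaw` and the
floor, ROW α1 under `Λ` gives `Rung2b₀Lci Λ σ 0` (`originLaw ⇒ originPicZeroLaw`, v42.4 `originPicZeroLaw_of_originLaw`). -/
theorem rung2b₀Lci_of_stubs {Λ : DatumLaw} {σ : DepthBoundA4.Design → ℤ}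
    (hO : ∀ (E₀ : AbelianVariety ℂ) (ψ₀ : E₀ ⟶ E₀) (δ : SplitBlockDatum₀ E₀ ψ₀), Λ E₀ ψ₀ δ → originLaw E₀ ψ₀ δ)
    (hfloor : ∀ (E₀ : AbelianVariety ℂ) (ψ₀ : E₀ ⟶ E₀) (δ : SplitBlockDatum₀ E₀ ψ₀), Λ E₀ ψ₀ δ →
      σ δ.Dsh.shadow ≤ (KunnethNoInterference.ext2 δ.S.X₃ : ℤ))
    (hα1 : Rung2b₀Under Λ 14 LeggedFloor.RuleD) : Rung2b₀Lci Λ σ 0 :=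
  rung2b₀Lci_of_stubs_pic (fun E₀ ψ₀ δ hΛ => originPicZeroLaw_of_originLaw (hO E₀ ψ₀ δ hΛ)) hfloor hα1

/-- **v4 (8σ)** under a law implying the decorated pin: floor = `KunnethNoInterference`, budget clause `BudgetClause sigmaH 0`. -/
theorem rung2b₀Lci_sigmaH_of_stubs_pic {Λ : DatumLaw}
    (hO : ∀ (E₀ : AbelianVariety ℂ) (ψ₀ : E₀ ⟶ E₀) (δ : SplitBlockDatum₀ E₀ ψ₀), Λ E₀ ψ₀ δ → originPicZeroLaw E₀ ψ₀ δ)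
    (hK : ∀ (E₀ : AbelianVariety ℂ) (ψ₀ : E₀ ⟶ E₀) (δ : SplitBlockDatum₀ E₀ ψ₀), Λ E₀ ψ₀ δ →
      KunnethNoInterference.KunnethNoInterference δ.Dsh.shadow δ.S.X₃)
    (hα1 : Rung2b₀Under Λ 14 LeggedFloor.RuleD) : Rung2b₀Lci Λ SigmaH.sigmaH 0 :=
  rung2b₀Lci_of_stubs_pic hO (fun E₀ ψ₀ δ hΛ => hK E₀ ψ₀ δ hΛ) hα1

/-- v3's **(8σ)** — VERBATIM, derived: floor = the named law `KunnethNoInterference` (`σ_H ≤ ext²`), budget clause `BudgetClause sigmaH 0` (`budgetClause_sigmaH_of_kni`). -/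
theorem rung2b₀Lci_sigmaH_of_stubs {Λ : DatumLaw}
    (hO : ∀ (E₀ : AbelianVariety ℂ) (ψ₀ : E₀ ⟶ E₀) (δ : SplitBlockDatum₀ E₀ ψ₀), Λ E₀ ψ₀ δ → originLaw E₀ ψ₀ δ)
    (hK : ∀ (E₀ : AbelianVariety ℂ) (ψ₀ : E₀ ⟶ E₀) (δ : SplitBlockDatum₀ E₀ ψ₀), Λ E₀ ψ₀ δ →
      KunnethNoInterference.KunnethNoInterference δ.Dsh.shadow δ.S.X₃)
    (hα1 : Rung2b₀Under Λ 14 LeggedFloor.RuleD) : Rung2b₀Lci Λ SigmaH.sigmaH 0 :=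
  rung2b₀Lci_of_stubs hO (fun E₀ ψ₀ δ hΛ => hK E₀ ψ₀ δ hΛ) hα1

/-- **v4 (8♮⁺)** under a law implying the decorated pin: floor = LEMMA Δ's `PhiAllPlusFloor`, budget clause `BudgetClause phiAllPlus 0`. -/
theorem rung2b₀Lci_phiAllPlus_of_stubs_pic {Λ : DatumLaw}
    (hO : ∀ (E₀ : AbelianVariety ℂ) (ψ₀ : E₀ ⟶ E₀) (δ : SplitBlockDatum₀ E₀ ψ₀), Λ E₀ ψ₀ δ → originPicZeroLaw E₀ ψ₀ δ)
    (hΔ : ∀ (E₀ : AbelianVariety ℂ) (ψ₀ : E₀ ⟶ E₀) (δ : SplitBlockDatum₀ E₀ ψ₀), Λ E₀ ψ₀ δ →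
      KunnethNoInterference.PhiAllPlusFloor δ.Dsh.shadow δ.S.X₃)
    (hα1 : Rung2b₀Under Λ 14 LeggedFloor.RuleD) : Rung2b₀Lci Λ KunnethNoInterference.phiAllPlus 0 :=
  rung2b₀Lci_of_stubs_pic hO (fun E₀ ψ₀ δ hΛ => hΔ E₀ ψ₀ δ hΛ) hα1

/-- v3's **(8♮⁺)** — VERBATIM, derived: floor = LEMMA Δ's decoration-free `PhiAllPlusFloor`, budget clause `BudgetClause phiAllPlus 0` (`budgetClause_phiAllPlus_of_floor`). -/
theorem rung2b₀Lci_phiAllPlus_of_stubs {Λ : DatumLaw}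
    (hO : ∀ (E₀ : AbelianVariety ℂ) (ψ₀ : E₀ ⟶ E₀) (δ : SplitBlockDatum₀ E₀ ψ₀), Λ E₀ ψ₀ δ → originLaw E₀ ψ₀ δ)
    (hΔ : ∀ (E₀ : AbelianVariety ℂ) (ψ₀ : E₀ ⟶ E₀) (δ : SplitBlockDatum₀ E₀ ψ₀), Λ E₀ ψ₀ δ →
      KunnethNoInterference.PhiAllPlusFloor δ.Dsh.shadow δ.S.X₃)
    (hα1 : Rung2b₀Under Λ 14 LeggedFloor.RuleD) : Rung2b₀Lci Λ KunnethNoInterference.phiAllPlus 0 :=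
  rung2b₀Lci_of_stubs hO (fun E₀ ψ₀ δ hΛ => hΔ E₀ ψ₀ δ hΛ) hα1

/-- **v4 (8σ) INSTANCE OF RECORD over the law parameter `S`, DECORATED GUARD**: ROW α1 under `lawSigmaPic S` (= `S ∧ originPicZeroLaw ∧ KNI`; projections
`h.2.1` = the decorated pin, `h.2.2` = the floor) ⟹ `Rung2b₀Lci (lawSigmaPic S) sigmaH 0` — the STRONGER record (wider guard: presentations pinned at the
origin UP TO `Pic⁰`-decoration); its α1 hypothesis is correspondingly the stronger α1 row. -/
theorem rung2b₀Lci_recordPic_sigmaH (S : DatumLaw) (hα1 : Rung2b₀Under (lawSigmaPic S) 14 LeggedFloor.RuleD) :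
    Rung2b₀Lci (lawSigmaPic S) SigmaH.sigmaH 0 :=
  rung2b₀Lci_sigmaH_of_stubs_pic (fun _ _ _ h => h.2.1) (fun _ _ _ h => h.2.2) hα1

/-- **v4 (8♮⁺) decorated twin**: ROW α1 under `lawNaturalPic S` ⟹ `Rung2b₀Lci (lawNaturalPic S) phiAllPlus 0` (DEAD CURRENCY at shell 2, (Φ′)(ii) — a true
implication recorded for symmetry; no kill of record in this currency). -/
theorem rung2b₀Lci_recordPic_phiAllPlus (S : DatumLaw) (hα1 : Rung2b₀Under (lawNaturalPic S) 14 LeggedFloor.RuleD) :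
    Rung2b₀Lci (lawNaturalPic S) KunnethNoInterference.phiAllPlus 0 :=
  rung2b₀Lci_phiAllPlus_of_stubs_pic (fun _ _ _ h => h.2.1) (fun _ _ _ h => h.2.2) hα1

/-- **RECOVERY OF THE v3 RECORD'S CONCLUSION BY NAME ((R-a) R19.900 ∕ R19.901)**: a 2b₀ record under the DECORATED σ-law implies the record of record under
v3's σ-law — v42.4's kill-side transport `rung2b₀Under_sigma_originLaw_of_originPicZeroLaw S lawKNI` (`lawSigmaPic S` ∕ `lawSigma S` ARE the lambdas it is
stated for; `Rung2b₀Lci Λ σ π := Rung2b₀Under Λ 14 (ShadowRows₀ RuleD lawPP σ π)`). -/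
theorem rung2b₀Lci_lawSigma_of_lawSigmaPic (S : DatumLaw) {σ : DepthBoundA4.Design → ℤ} {π : ℤ} (h : Rung2b₀Lci (lawSigmaPic S) σ π) :
    Rung2b₀Lci (lawSigma S) σ π :=
  rung2b₀Under_sigma_originLaw_of_originPicZeroLaw S lawKNI h

/-- … row-parametric: any row list under `lawSigmaPic S` implies the same rows under `lawSigma S` (same transport). -/
theorem rung2b₀Under_lawSigma_of_lawSigmaPic (S : DatumLaw) {h : ℤ} {Rows : DepthBoundA4.Design → Prop} (H : Rung2b₀Under (lawSigmaPic S) h Rows) :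
    Rung2b₀Under (lawSigma S) h Rows :=
  rung2b₀Under_sigma_originLaw_of_originPicZeroLaw S lawKNI H

/-- … and the (8♮⁺) twin (transport with `K := lawFloor`). -/
theorem rung2b₀Lci_lawNatural_of_lawNaturalPic (S : DatumLaw) {σ : DepthBoundA4.Design → ℤ} {π : ℤ} (h : Rung2b₀Lci (lawNaturalPic S) σ π) :
    Rung2b₀Lci (lawNatural S) σ π :=
  rung2b₀Under_sigma_originLaw_of_originPicZeroLaw S lawFloor h

/-- … and the floor-free pinned laws (v42.4 `rung2b₀Under_and_originLaw_of_originPicZeroLaw S`). -/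
theorem rung2b₀Under_lawPinned_of_lawPinnedPic (S : DatumLaw) {h : ℤ} {Rows : DepthBoundA4.Design → Prop} (H : Rung2b₀Under (lawPinnedPic S) h Rows) :
    Rung2b₀Under (lawPinned S) h Rows :=
  rung2b₀Under_and_originLaw_of_originPicZeroLaw S H

/-- **(8σ) INSTANCE OF RECORD over the law parameter `S`**: ROW α1 under the law of record `lawSigma S` (= `S ∧ originLaw ∧ KNI`, that conjunct order;
projections `h.2.1` = the pin, `h.2.2` = the floor) ⟹ `Rung2b₀Lci (lawSigma S) sigmaH 0`.  An α1 proved under fewer antecedents lifts here by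
`rung2b₀Under_antitone` (`…_of_pinned`, `…_static`). -/
theorem rung2b₀Lci_record_sigmaH (S : DatumLaw) (hα1 : Rung2b₀Under (lawSigma S) 14 LeggedFloor.RuleD) :
    Rung2b₀Lci (lawSigma S) SigmaH.sigmaH 0 :=
  rung2b₀Lci_sigmaH_of_stubs (fun _ _ _ h => h.2.1) (fun _ _ _ h => h.2.2) hα1

/-- **(8♮⁺) INSTANCE OF RECORD over `S`**: ROW α1 under `lawNatural S` (= `S ∧ originLaw ∧ LEMMA Δ floor`) ⟹ `Rung2b₀Lci (lawNatural S) phiAllPlus 0`. -/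
theorem rung2b₀Lci_record_phiAllPlus (S : DatumLaw) (hα1 : Rung2b₀Under (lawNatural S) 14 LeggedFloor.RuleD) :
    Rung2b₀Lci (lawNatural S) KunnethNoInterference.phiAllPlus 0 :=
  rung2b₀Lci_phiAllPlus_of_stubs (fun _ _ _ h => h.2.1) (fun _ _ _ h => h.2.2) hα1

/-- lifting an α1 row proved under the floor-free PINNED law `lawPinned S = S ∧ originLaw` to both laws of record (`rung2b₀Under_antitone`). -/
theorem rung2b₀Under_ruleD_record_of_pinned (S : DatumLaw) (hα1 : Rung2b₀Under (lawPinned S) 14 LeggedFloor.RuleD) :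
    Rung2b₀Under (lawSigma S) 14 LeggedFloor.RuleD ∧ Rung2b₀Under (lawNatural S) 14 LeggedFloor.RuleD :=
  ⟨rung2b₀Under_antitone (lawPinned_of_lawSigma S) hα1, rung2b₀Under_antitone (lawPinned_of_lawNatural S) hα1⟩

/-- **v4**: lifting an α1 row proved under the floor-free DECORATED-PINNED law `lawPinnedPic S = S ∧ originPicZeroLaw` to both decorated laws
(`rung2b₀Under_antitone`) — and, through `rung2b₀Under_lawPinned_of_lawPinnedPic`, to everything the v3 pinned α1 row feeds. -/
theorem rung2b₀Under_ruleD_recordPic_of_picPinned (S : DatumLaw) (hα1 : Rung2b₀Under (lawPinnedPic S) 14 LeggedFloor.RuleD) :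
    Rung2b₀Under (lawSigmaPic S) 14 LeggedFloor.RuleD ∧ Rung2b₀Under (lawNaturalPic S) 14 LeggedFloor.RuleD :=
  ⟨rung2b₀Under_antitone (lawPinnedPic_of_lawSigmaPic S) hα1, rung2b₀Under_antitone (lawPinnedPic_of_lawNaturalPic S) hα1⟩

/-- **ROW α1, ORIGIN-PINNED, PER SELECTOR — line-local vocabulary ((W‴) R19.892, officer AUDIT 133 (F3); a `def`, NOT a stub, NOT registered).**
For a tangent-family selector `W : StaticAlongTW.TangentFamilySelector` (layer B, semihom-1 g68: on every anchor a Weil tangent family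
`T_W(E₀, ψ₀) ≤ T¹(S⁴∕ℂ)` — a PARAMETER): RULE D of the shell shadow for every CM anchor and every C-free datum that is STATIC ALONG `W`
(`StaticAlongTW.StaticAlongTW W`, the named C-free law of R19.858 (b): the cokernel bundle `𝓔 = δ₀.S.X₃` is first-order unobstructed along `T_W`) AND
ORIGIN-PINNED, positive, passing, in scope — `Rung2b₀Under (StaticAlongTW W ∧ originLaw) 14 LeggedFloor.RuleD`, i.e.
`Rung2b₀Under (lawPinned (StaticAlongTW.StaticAlongTW W)) 14 RuleD` (`alpha1RowPinned_iff`).  It is the origin-pinned twin of layer B's tie-guarded register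
form `StaticAlongTW.Alpha1RowTied W` (under (P′) the σ-law has no `Realisable` conjunct, so the (W″) feed through `StaticAlongTW.alpha1_of_le_lawStaticTied`
does not type — AUDIT 133 (F1), kernel — and (F2)'s unguarded `StaticAlongTW.Alpha1Row W` as the hypothesis of record would contradict (P′)(i); it still
IMPLIES this form, `alpha1RowPinned_of_alpha1Row`).  It READS `Passes` (hsem-3 memo-212 R0: `Critic.alpha1Bridge_forces_levelZero` kills every `Passes`-free
α1 bridge under a padding-stable law) and the pin ((P′)(i)).
**α1 is supplied PER SELECTOR AS A HYPOTHESIS `hα1 : Alpha1RowPinned W` of the record ∕ kill theorems below; NO α1 stub is registered** ((W″) R19.891 ∕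
hsem-2 memo-181: `theorem stub_alpha1 (W : TangentFamilySelector) : … := by sorry` is a Π-constant `∀ W, …` over every 16-plane, ψ₀-blind — what (W′)
forbids («never a universal claim over arbitrary 16-planes»), and unprovable from pen THEOREM P even if P is true).  The INTENDED selector is the
ψ₀-Weil tangent family — DEFINITION REQUEST D-L2a `weilTangentFamily E₀ ψ₀` (its defining property must make the family depend on ψ₀, through
`pad4Action E₀ ψ₀` — memo-181 (B4): the bare `WeilTangentFamily E₀ ψ₀` type is ψ₀-blind), with the Künneth letter dictionary D-L2c (semihom-1 g68 memo
`STATIC-ALONG-TW-semihom1-g68.md` a8fe89942c67b19b §3); **when D-L2a lands as a decl, `stub_alpha1 : Alpha1RowPinned (weilTangentFamily …)` is registered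
(closed parameter; pen source THEOREM P restricted to origin-pinned presentations) — not before.**
**v4 ((R-a) R19.900 ∕ R19.901): KEPT VERBATIM.**  Its DECORATED twin is the hypothesis shape `Rung2b₀Under (lawPinnedPic (StaticAlongTW.StaticAlongTW W)) 14 RuleD`
(RULE D for static-along-`W` data pinned at the origin UP TO `Pic⁰`; the STRONGER α1 row), which FEEDS this one by v42.4's
`rung2b₀Under_and_originLaw_of_originPicZeroLaw` (`alpha1RowPinned_of_picPinned`) and serves the decorated (8σ) record (`rung2b₀Lci_recordPic_sigmaH_static ∕
_of_static`); `Alpha1RowPinned W` by itself feeds the v3 records only — an α1 under the origin guard does NOT give the α1 under the decorated guard. -/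
def Alpha1RowPinned (W : StaticAlongTW.TangentFamilySelector) : Prop :=
  Rung2b₀Under (fun E₀ ψ₀ δ₀ => StaticAlongTW.StaticAlongTW W E₀ ψ₀ δ₀ ∧ originLaw E₀ ψ₀ δ₀) 14 LeggedFloor.RuleD

/-- `Alpha1RowPinned W` IS `Rung2b₀Under (lawPinned (StaticAlongTW.StaticAlongTW W)) 14 RuleD` (definitionally). -/
theorem alpha1RowPinned_iff (W : StaticAlongTW.TangentFamilySelector) :
    Alpha1RowPinned W ↔ Rung2b₀Under (lawPinned (StaticAlongTW.StaticAlongTW W)) 14 LeggedFloor.RuleD :=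
  Iff.rfl

/-- … spelled out in the F6 shape of record: CM anchor → `StaticAlongTW W δ₀ ∧ originLaw δ₀` → `Positive` → `Passes` → `ScopeRows 14` → `RuleD (shadow)`. -/
theorem alpha1RowPinned_iff' (W : StaticAlongTW.TangentFamilySelector) :
    Alpha1RowPinned W ↔
      ∀ (E₀ : AbelianVariety ℂ) (ψ₀ : E₀ ⟶ E₀), E₀.dim = 1 → ψ₀ ≫ ψ₀ = -(1 • 𝟙 E₀) →
        ∀ δ₀ : SplitBlockDatum₀ E₀ ψ₀, StaticAlongTW.StaticAlongTW W E₀ ψ₀ δ₀ ∧ originLaw E₀ ψ₀ δ₀ → δ₀.Dsh.Positive → δ₀.Passes →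
          ScopeRows 14 δ₀.Dsh.shadow → LeggedFloor.RuleD δ₀.Dsh.shadow :=
  Iff.rfl

/-- layer B's UNGUARDED bare-law row `StaticAlongTW.Alpha1Row W` (the (F2) form; the strongest α1, RULE D from staticity alone) implies the pinned row
(`rung2b₀Under_antitone`) — recorded so that a THEOREM P delivered in the strong form still feeds the records; it is NOT the hypothesis of record. -/
theorem alpha1RowPinned_of_alpha1Row (W : StaticAlongTW.TangentFamilySelector) (h : StaticAlongTW.Alpha1Row W) : Alpha1RowPinned W :=
  rung2b₀Under_antitone (fun _ _ _ h' => h'.1) h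

/-- **v4 — THE DECORATED FEED ((R-a) R19.900 ∕ R19.901, v42.4 `rung2b₀Under_and_originLaw_of_originPicZeroLaw` BY NAME)**: ROW α1 for static-along-`W` data
pinned at the origin UP TO `Pic⁰` (`Rung2b₀Under (lawPinnedPic (StaticAlongTW.StaticAlongTW W)) 14 RuleD`, the stronger row) ⟹ `Alpha1RowPinned W`. -/
theorem alpha1RowPinned_of_picPinned (W : StaticAlongTW.TangentFamilySelector)
    (h : Rung2b₀Under (lawPinnedPic (StaticAlongTW.StaticAlongTW W)) 14 LeggedFloor.RuleD) : Alpha1RowPinned W :=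
  rung2b₀Under_and_originLaw_of_originPicZeroLaw (StaticAlongTW.StaticAlongTW W) h

/-- layer B's UNGUARDED bare-law row `StaticAlongTW.Alpha1Row W` ((F2) form) implies the decorated-pinned α1 row too (`rung2b₀Under_antitone`) — recorded so
that a THEOREM P delivered in the strong form feeds the v4 records; NOT the hypothesis of record. -/
theorem alpha1RowPicPinned_of_alpha1Row (W : StaticAlongTW.TangentFamilySelector) (h : StaticAlongTW.Alpha1Row W) :
    Rung2b₀Under (lawPinnedPic (StaticAlongTW.StaticAlongTW W)) 14 LeggedFloor.RuleD :=
  rung2b₀Under_antitone (fun _ _ _ h' => h'.1) h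

/-- **THE (8σ) RECORD FEED, SELECTOR-FED, 0 sorry ((W‴) R19.892; `S := StaticAlongTW.StaticAlongTW W` BY DECL NAME — officer π3 ∕ G5′, J q3).**
ROW α1 origin-pinned along `W` (hypothesis) ⟹ ROW α1 under the law of record `lawSigma (StaticAlongTW.StaticAlongTW W)` =
`StaticAlongTW W ∧ originLaw ∧ KNI` — projections `⟨h'.1, h'.2.1⟩` to the conjunct order `S ∧ originLaw ∧ KNI`, by `rung2b₀Under_antitone`. -/
theorem rung2b₀Lci_record_sigmaH_static (W : StaticAlongTW.TangentFamilySelector) (hα1 : Alpha1RowPinned W) :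
    Rung2b₀Under (lawSigma (StaticAlongTW.StaticAlongTW W)) 14 LeggedFloor.RuleD :=
  rung2b₀Under_antitone (fun _ _ _ h' => ⟨h'.1, h'.2.1⟩) hα1

/-- … composed with the (8σ) record assembly exactly where v2 consumed the α1 row: **from the five stubs and `hα1 : Alpha1RowPinned W`,
`Rung2b₀Lci (lawSigma (StaticAlongTW.StaticAlongTW W)) sigmaH 0`** — all eight v42 rows of record, height 14, rider 0, under «static along `W` ∧
origin-pinned ∧ KNI» (sorry only through the four sorried row stubs). -/
theorem rung2b₀Lci_record_sigmaH_of_static (W : StaticAlongTW.TangentFamilySelector) (hα1 : Alpha1RowPinned W) :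
    Rung2b₀Lci (lawSigma (StaticAlongTW.StaticAlongTW W)) SigmaH.sigmaH 0 :=
  rung2b₀Lci_record_sigmaH (StaticAlongTW.StaticAlongTW W) (rung2b₀Lci_record_sigmaH_static W hα1)

/-- the (8♮⁺) feed twin: ROW α1 origin-pinned along `W` ⟹ ROW α1 under `lawNatural (StaticAlongTW.StaticAlongTW W)` = `StaticAlongTW W ∧ originLaw ∧ floor`. -/
theorem rung2b₀Lci_record_phiAllPlus_static (W : StaticAlongTW.TangentFamilySelector) (hα1 : Alpha1RowPinned W) :
    Rung2b₀Under (lawNatural (StaticAlongTW.StaticAlongTW W)) 14 LeggedFloor.RuleD :=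
  rung2b₀Under_antitone (fun _ _ _ h' => ⟨h'.1, h'.2.1⟩) hα1

/-- the (8♮⁺) record twin: `Rung2b₀Lci (lawNatural (StaticAlongTW.StaticAlongTW W)) phiAllPlus 0` from the stubs and `hα1 : Alpha1RowPinned W`. -/
theorem rung2b₀Lci_record_phiAllPlus_of_static (W : StaticAlongTW.TangentFamilySelector) (hα1 : Alpha1RowPinned W) :
    Rung2b₀Lci (lawNatural (StaticAlongTW.StaticAlongTW W)) KunnethNoInterference.phiAllPlus 0 :=
  rung2b₀Lci_record_phiAllPlus (StaticAlongTW.StaticAlongTW W) (rung2b₀Lci_record_phiAllPlus_static W hα1)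

/-- **v4 — THE DECORATED (8σ) RECORD FEED, SELECTOR-FED, 0 sorry** (`S := StaticAlongTW.StaticAlongTW W` BY DECL NAME): ROW α1 decorated-pinned along `W`
(hypothesis shape `Rung2b₀Under (lawPinnedPic (StaticAlongTW.StaticAlongTW W)) 14 RuleD`) ⟹ ROW α1 under `lawSigmaPic (StaticAlongTW.StaticAlongTW W)` =
`StaticAlongTW W ∧ originPicZeroLaw ∧ KNI` — projections `⟨h'.1, h'.2.1⟩`, by `rung2b₀Under_antitone`. -/
theorem rung2b₀Lci_recordPic_sigmaH_static (W : StaticAlongTW.TangentFamilySelector)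
    (hα1 : Rung2b₀Under (lawPinnedPic (StaticAlongTW.StaticAlongTW W)) 14 LeggedFloor.RuleD) :
    Rung2b₀Under (lawSigmaPic (StaticAlongTW.StaticAlongTW W)) 14 LeggedFloor.RuleD :=
  rung2b₀Under_antitone (lawPinnedPic_of_lawSigmaPic (StaticAlongTW.StaticAlongTW W)) hα1

/-- … composed with the decorated (8σ) record: **from the five stubs and the decorated-pinned α1 row along `W`,
`Rung2b₀Lci (lawSigmaPic (StaticAlongTW.StaticAlongTW W)) sigmaH 0`** — all eight v42 rows of record, height 14, rider 0, under «static along `W` ∧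
origin-pinned up to `Pic⁰` ∧ KNI» (sorry only through the four sorried row stubs); implies v3's `rung2b₀Lci_record_sigmaH_of_static W (alpha1RowPinned_of_picPinned W hα1)`
(`rung2b₀Lci_lawSigma_of_lawSigmaPic`). -/
theorem rung2b₀Lci_recordPic_sigmaH_of_static (W : StaticAlongTW.TangentFamilySelector)
    (hα1 : Rung2b₀Under (lawPinnedPic (StaticAlongTW.StaticAlongTW W)) 14 LeggedFloor.RuleD) :
    Rung2b₀Lci (lawSigmaPic (StaticAlongTW.StaticAlongTW W)) SigmaH.sigmaH 0 :=
  rung2b₀Lci_recordPic_sigmaH (StaticAlongTW.StaticAlongTW W) (rung2b₀Lci_recordPic_sigmaH_static W hα1)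

/-- consistency: the decorated selector-fed record yields the v3 selector-fed record's conclusion (transport) — the same term v3 builds from the fed α1. -/
example (W : StaticAlongTW.TangentFamilySelector) (hα1 : Rung2b₀Under (lawPinnedPic (StaticAlongTW.StaticAlongTW W)) 14 LeggedFloor.RuleD) :
    Rung2b₀Lci (lawSigma (StaticAlongTW.StaticAlongTW W)) SigmaH.sigmaH 0 :=
  rung2b₀Lci_lawSigma_of_lawSigmaPic (StaticAlongTW.StaticAlongTW W) (rung2b₀Lci_recordPic_sigmaH_of_static W hα1)

example (W : StaticAlongTW.TangentFamilySelector) (hα1 : Rung2b₀Under (lawPinnedPic (StaticAlongTW.StaticAlongTW W)) 14 LeggedFloor.RuleD) :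
    Rung2b₀Lci (lawSigma (StaticAlongTW.StaticAlongTW W)) SigmaH.sigmaH 0 :=
  rung2b₀Lci_record_sigmaH_of_static W (alpha1RowPinned_of_picPinned W hα1)

/-- **v4 — B136 EXCLUDED DECORATION-FREE under the decorated pin** (R19.865 (d); `KunnethNoInterference.not_extBudgetRow_B136`, `phiAllPlus B136 = 3 808 > 3 136`):
under LEMMA Δ's floor, NO decorated-origin-pinned positive passing in-scope datum has shell shadow `B136` — given `stub_extBudget`. -/
theorem shadow_ne_B136_of_floor_pic {E₀ : AbelianVariety ℂ} {ψ₀ : E₀ ⟶ E₀} (hE : E₀.dim = 1) (hψ : ψ₀ ≫ ψ₀ = -(1 • 𝟙 E₀))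
    (δ : SplitBlockDatum₀ E₀ ψ₀) (hpin : originPicZeroLaw E₀ ψ₀ δ) (hpos : δ.Dsh.Positive) (hpass : δ.Passes) (hscope : ScopeRows 14 δ.Dsh.shadow)
    (hf : KunnethNoInterference.PhiAllPlusFloor δ.Dsh.shadow δ.S.X₃) : δ.Dsh.shadow ≠ HallB136.B136 := by
  intro hB
  have h := stub_extBudget E₀ ψ₀ hE hψ δ hpin hpos hpass hscope
  rw [hB] at h hf
  exact KunnethNoInterference.not_extBudgetRow_B136 hf 0 le_rfl h

/-- v3's **B136 EXCLUDED DECORATION-FREE** — VERBATIM, derived: under LEMMA Δ's floor, NO origin-pinned positive passing in-scope datum has shell shadow `B136`. -/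
theorem shadow_ne_B136_of_floor {E₀ : AbelianVariety ℂ} {ψ₀ : E₀ ⟶ E₀} (hE : E₀.dim = 1) (hψ : ψ₀ ≫ ψ₀ = -(1 • 𝟙 E₀))
    (δ : SplitBlockDatum₀ E₀ ψ₀) (hpin : originLaw E₀ ψ₀ δ) (hpos : δ.Dsh.Positive) (hpass : δ.Passes) (hscope : ScopeRows 14 δ.Dsh.shadow)
    (hf : KunnethNoInterference.PhiAllPlusFloor δ.Dsh.shadow δ.S.X₃) : δ.Dsh.shadow ≠ HallB136.B136 :=
  shadow_ne_B136_of_floor_pic hE hψ δ (originPicZeroLaw_of_originLaw hpin) hpos hpass hscope hf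

end Assembly

/-! ## §5 THE KILL PATH (sorry-free, hypothesis-carrying, law-restricted — never against `DatumLaw.trivial`) and its honest reading

REACH, v4 ((R-a) R19.894 ∕ R19.900 ∕ R19.901): kills under `lawSigmaPic` bear on reach presentations PINNED AT THE ORIGIN UP TO A `Pic⁰`-DECORATION
(v42.4 `originPicZeroLaw`; they imply the v3 kills under `lawSigma`, `not_rung2a₀Under_lawSigma_of_not_lawSigmaPic`); RELABEL-INVARIANCE of the decorated
guard (v42.4 `rows_relabel_iff_of_originPicZeroLaw`): relabel-invariance up to `Pic⁰`-decoration holds UNCONDITIONALLY (`originDecSeparating_holds`) — the kernel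
theorem `OriginSep.originDecSeparating_holds` (sheaf8-1 g10 `OriginSeparatingReduction.lean` v2.1 9f3f39ac5dfbc894, 0 sorry, std axioms; officer AUDIT 140 PLATE
#119 PASS; director R19.910 (O″)), cited, NOT imported (docstring citation, R19.907 ∕ R19.910); decorations beyond `Pic⁰` and
undecorated-but-unpinned presentations stay out of reach (memo-214 (f7), `ReachModDec` open); the on-path `stub_rung2a : Rung2a₀ 14` is law-free and
unaffected.  CURRENCY ((Φ′)(ii) R19.898): the (8♮) kills are DEAD CURRENCY at shell 2 (room inhabited on sheaf8-1 g10's numerics); the kill currency of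
record is (8σ) — under `lawSigmaPic` (v4) ⟹ under `lawSigma` (v3, kept). -/

section KillPath

/-- **v4 — THE KILL, law-parametric, DECORATED PIN**: ROW α1 under `Λ` + (Λ ⟹ decorated origin pin, floor) + THE CLOSED v42 ROOM `SPlus₀ RuleD lawPP 14 σ 0`
⟹ NO law-abiding positive passing in-scope C-free datum exists at height 14 (v42.1 `not_rung2a₀Under_of_rung2b₀Lci`).  Retires the split-block ANSATZ
RESTRICTED TO THE LAW, in that row currency — NOT `Rung2a₀ 14`, NOT `stub_rung_pad4_seedAt`, NOT the crux.  REACH ((R-a)): with `Λ ⟹ originPicZeroLaw` this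
refutes law-abiding DRESSINGS `(Dsh, k)` pinned at the origin up to `Pic⁰`-decoration; the on-path door is law-free and unaffected. -/
theorem not_rung2a₀Under_of_stubs_pic {Λ : DatumLaw} {σ : DepthBoundA4.Design → ℤ}
    (hO : ∀ (E₀ : AbelianVariety ℂ) (ψ₀ : E₀ ⟶ E₀) (δ : SplitBlockDatum₀ E₀ ψ₀), Λ E₀ ψ₀ δ → originPicZeroLaw E₀ ψ₀ δ)
    (hfloor : ∀ (E₀ : AbelianVariety ℂ) (ψ₀ : E₀ ⟶ E₀) (δ : SplitBlockDatum₀ E₀ ψ₀), Λ E₀ ψ₀ δ →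
      σ δ.Dsh.shadow ≤ (KunnethNoInterference.ext2 δ.S.X₃ : ℤ))
    (hα1 : Rung2b₀Under Λ 14 LeggedFloor.RuleD) (hS : SPlus₀ LeggedFloor.RuleD lawPP 14 σ 0) : ¬ Rung2a₀Under Λ 14 :=
  not_rung2a₀Under_of_rung2b₀Lci (rung2b₀Lci_of_stubs_pic hO hfloor hα1) hS

/-- **v4 (8σ) KILL OF RECORD over `S`, DECORATED GUARD**: ROW α1 under `lawSigmaPic S` + the closed room `SPlus₀ RuleD lawPP 14 sigmaH 0` ⟹
`¬ Rung2a₀Under (lawSigmaPic S) 14` — no positive passing in-scope C-free datum at height 14 that is `S`-abiding, KNI-abiding and pinned at the origin up to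
`Pic⁰`-decoration. -/
theorem not_rung2a₀Under_recordPic_sigmaH (S : DatumLaw) (hα1 : Rung2b₀Under (lawSigmaPic S) 14 LeggedFloor.RuleD)
    (hS : SPlus₀ LeggedFloor.RuleD lawPP 14 SigmaH.sigmaH 0) : ¬ Rung2a₀Under (lawSigmaPic S) 14 :=
  not_rung2a₀Under_of_rung2b₀Lci (rung2b₀Lci_recordPic_sigmaH S hα1) hS

/-- **v4 (8σ) KILL OF RECORD, SELECTOR-FED, DECORATED GUARD** (`S := StaticAlongTW.StaticAlongTW W` by decl name): ROW α1 decorated-pinned along `W`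
(hypothesis shape `Rung2b₀Under (lawPinnedPic (StaticAlongTW.StaticAlongTW W)) 14 RuleD`) + the closed room `SPlus₀ RuleD lawPP 14 sigmaH 0` ⟹ NO positive
passing in-scope C-free datum at height 14 that is static along `W`, pinned at the origin up to `Pic⁰`-decoration and KNI-abiding.  Implies v3's
`not_rung2a₀Under_record_sigmaH_of_static W (alpha1RowPinned_of_picPinned W hα1) hS`. -/
theorem not_rung2a₀Under_recordPic_sigmaH_of_static (W : StaticAlongTW.TangentFamilySelector)
    (hα1 : Rung2b₀Under (lawPinnedPic (StaticAlongTW.StaticAlongTW W)) 14 LeggedFloor.RuleD)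
    (hS : SPlus₀ LeggedFloor.RuleD lawPP 14 SigmaH.sigmaH 0) : ¬ Rung2a₀Under (lawSigmaPic (StaticAlongTW.StaticAlongTW W)) 14 :=
  not_rung2a₀Under_of_rung2b₀Lci (rung2b₀Lci_recordPic_sigmaH_of_static W hα1) hS

/-- **REACH COMPARISON (v4 ⊇ v3)**: a `lawSigma S`-abiding 2a₀ datum is a `lawSigmaPic S`-abiding one (`originPicZeroLaw_of_originLaw`) … -/
theorem rung2a₀Under_lawSigmaPic_of_lawSigma (S : DatumLaw) {h : ℤ} (h2a : Rung2a₀Under (lawSigma S) h) : Rung2a₀Under (lawSigmaPic S) h := by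
  obtain ⟨E₀, ψ₀, hE, hψ, δ, hΛ, hpos, hpass, hscope⟩ := h2a
  exact ⟨E₀, ψ₀, hE, hψ, δ, lawSigmaPic_of_lawSigma S E₀ ψ₀ δ hΛ, hpos, hpass, hscope⟩

/-- … so the DECORATED kill implies the v3 kill of record: `¬ Rung2a₀Under (lawSigmaPic S) 14 → ¬ Rung2a₀Under (lawSigma S) 14` (strictly wider reach,
modulo the classes `Pic⁰ ∖ {𝒪}`). -/
theorem not_rung2a₀Under_lawSigma_of_not_lawSigmaPic (S : DatumLaw) {h : ℤ} (hn : ¬ Rung2a₀Under (lawSigmaPic S) h) : ¬ Rung2a₀Under (lawSigma S) h :=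
  fun h2a => hn (rung2a₀Under_lawSigmaPic_of_lawSigma S h2a)

/-- **WHAT A DECORATED KILL OF RECORD BEARS ON**: a `lawSigmaPic S`-abiding 2a₀ datum is a `Pic⁰`-DECORATED-PINNED 2a₀ datum — v42.4's door
`Rung2a₀PicZero 14` (`= Rung2a₀Under originPicZeroLaw 14`) — which is a 2a₀ datum (`rung2a₀_of_rung2a₀PicZero`); so `¬ Rung2a₀Under (lawSigmaPic S) 14`
retires the `S ∧ KNI`-abiding part of the DECORATED-PINNED door only: neither `Rung2a₀PicZero 14`, nor `Rung2a₀Origin 14`, nor the law-free on-path `Rung2a₀ 14`. -/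
theorem rung2a₀PicZero_of_rung2a₀Under_lawSigmaPic (S : DatumLaw) {h : ℤ} (h2a : Rung2a₀Under (lawSigmaPic S) h) : Rung2a₀PicZero h := by
  obtain ⟨E₀, ψ₀, hE, hψ, δ, hΛ, hpos, hpass, hscope⟩ := h2a
  exact ⟨E₀, ψ₀, hE, hψ, δ, hΛ.2.1, hpos, hpass, hscope⟩

theorem rung2a₀_of_rung2a₀Under_lawSigmaPic (S : DatumLaw) {h : ℤ} (h2a : Rung2a₀Under (lawSigmaPic S) h) : Rung2a₀ h :=
  rung2a₀_of_rung2a₀PicZero (rung2a₀PicZero_of_rung2a₀Under_lawSigmaPic S h2a)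

/-- v3's **THE KILL, law-parametric** — VERBATIM statement, derived through `rung2b₀Lci_of_stubs`: ROW α1 under `Λ` + (Λ ⟹ origin pin, floor) + THE CLOSED
v42 ROOM `SPlus₀ RuleD lawPP 14 σ 0` ⟹ NO law-abiding positive passing in-scope C-free datum exists at height 14 (v42.1 `not_rung2a₀Under_of_rung2b₀Lci`).
Retires the split-block ANSATZ RESTRICTED TO THE LAW, in that row currency — NOT `Rung2a₀ 14`, NOT `stub_rung_pad4_seedAt`, NOT the crux.  Rows read
`Dsh.shadow`, which the C-free presentation does not determine (hsem-3 memo-212 (f6); F8): with `Λ ⟹ originLaw` this refutes ORIGIN-PINNED law-abiding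
DRESSINGS `(Dsh, k)` (v3 reach (P″); v4's `_pic` twin above reaches the `Pic⁰`-decorated ones); the on-path door is law-free and unaffected. -/
theorem not_rung2a₀Under_of_stubs {Λ : DatumLaw} {σ : DepthBoundA4.Design → ℤ}
    (hO : ∀ (E₀ : AbelianVariety ℂ) (ψ₀ : E₀ ⟶ E₀) (δ : SplitBlockDatum₀ E₀ ψ₀), Λ E₀ ψ₀ δ → originLaw E₀ ψ₀ δ)
    (hfloor : ∀ (E₀ : AbelianVariety ℂ) (ψ₀ : E₀ ⟶ E₀) (δ : SplitBlockDatum₀ E₀ ψ₀), Λ E₀ ψ₀ δ →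
      σ δ.Dsh.shadow ≤ (KunnethNoInterference.ext2 δ.S.X₃ : ℤ))
    (hα1 : Rung2b₀Under Λ 14 LeggedFloor.RuleD) (hS : SPlus₀ LeggedFloor.RuleD lawPP 14 σ 0) : ¬ Rung2a₀Under Λ 14 :=
  not_rung2a₀Under_of_rung2b₀Lci (rung2b₀Lci_of_stubs hO hfloor hα1) hS

/-- **(8σ) KILL OF RECORD over `S`**: ROW α1 under `lawSigma S` + the closed room `SPlus₀ RuleD lawPP 14 sigmaH 0` ⟹ `¬ Rung2a₀Under (lawSigma S) 14`. -/
theorem not_rung2a₀Under_record_sigmaH (S : DatumLaw) (hα1 : Rung2b₀Under (lawSigma S) 14 LeggedFloor.RuleD)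
    (hS : SPlus₀ LeggedFloor.RuleD lawPP 14 SigmaH.sigmaH 0) : ¬ Rung2a₀Under (lawSigma S) 14 :=
  not_rung2a₀Under_of_rung2b₀Lci (rung2b₀Lci_record_sigmaH S hα1) hS

/-- **(8♮⁺) KILL OF RECORD over `S`**: with the closed room in the `phiAllPlus` currency.  **DEAD CURRENCY ((Φ′)(ii) R19.898): the closed-room hypothesis
`SPlus₀ RuleD lawPP 14 phiAllPlus 0` is FALSE at shell 2 (hub40 b14fa640c6e6a2ea; sheaf8-1 g10 RESULT-2, memo `DOORS-PHI-SHELL2-INHABITED-sheaf8-1-g10.md`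
3c22f0d2c0a5e783: the (8♮) room is inhabited at shell 2 on sheaf8-1 g10's numerics — W 705e47be06997404 ∕ hub40; kernel side `DoorSPhiShellTwo.lean`
578157cf42c8e63e `not_diag_le_phiAllPlus`); this implication stays (TRUE) but cannot fire as typed (officer AUDIT 135 π7); kill currency of record = (8σ)
under `lawSigma` (`not_rung2a₀Under_record_sigmaH ∕ _of_static`).**  What would revive a decoration-free kill: a floor SHARPENED on legged blocks (LEMMA Δ's
silent case; (Φ′)(iv), not commissioned). -/
theorem not_rung2a₀Under_record_phiAllPlus (S : DatumLaw) (hα1 : Rung2b₀Under (lawNatural S) 14 LeggedFloor.RuleD)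
    (hS : SPlus₀ LeggedFloor.RuleD lawPP 14 KunnethNoInterference.phiAllPlus 0) : ¬ Rung2a₀Under (lawNatural S) 14 :=
  not_rung2a₀Under_of_rung2b₀Lci (rung2b₀Lci_record_phiAllPlus S hα1) hS

/-- **(8σ) KILL OF RECORD, SELECTOR-FED ((W‴); `S := StaticAlongTW.StaticAlongTW W` by decl name)** — v3 VERBATIM: ROW α1 origin-pinned along `W`
(hypothesis `Alpha1RowPinned W`) + the closed room `SPlus₀ RuleD lawPP 14 sigmaH 0` ⟹ NO positive passing in-scope C-free datum at height 14 that is static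
along `W`, origin-pinned and KNI-abiding.  REACH of THIS statement ((P″)): origin-pinned (undecorated) presentations; the decorated twin
`not_rung2a₀Under_recordPic_sigmaH_of_static` (stronger α1 hypothesis) reaches the `Pic⁰`-decorated ones; `stub_rung2a : Rung2a₀ 14` is law-free and unaffected. -/
theorem not_rung2a₀Under_record_sigmaH_of_static (W : StaticAlongTW.TangentFamilySelector) (hα1 : Alpha1RowPinned W)
    (hS : SPlus₀ LeggedFloor.RuleD lawPP 14 SigmaH.sigmaH 0) : ¬ Rung2a₀Under (lawSigma (StaticAlongTW.StaticAlongTW W)) 14 :=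
  not_rung2a₀Under_of_rung2b₀Lci (rung2b₀Lci_record_sigmaH_of_static W hα1) hS

/-- the (8♮⁺) selector-fed kill twin — DEAD CURRENCY at shell 2 ((Φ′)(ii): its room hypothesis is false as typed; kept as a true implication). -/
theorem not_rung2a₀Under_record_phiAllPlus_of_static (W : StaticAlongTW.TangentFamilySelector) (hα1 : Alpha1RowPinned W)
    (hS : SPlus₀ LeggedFloor.RuleD lawPP 14 KunnethNoInterference.phiAllPlus 0) : ¬ Rung2a₀Under (lawNatural (StaticAlongTW.StaticAlongTW W)) 14 :=
  not_rung2a₀Under_of_rung2b₀Lci (rung2b₀Lci_record_phiAllPlus_of_static W hα1) hS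

/-- **WHAT A KILL OF RECORD BEARS ON**: a `lawSigma S`-abiding 2a₀ datum is an ORIGIN-PINNED 2a₀ datum — v42.3's pinned door `Rung2a₀Origin 14`
(`= Rung2a₀Under originLaw 14`) — which is a 2a₀ datum (`rung2a₀_of_rung2a₀Origin`); so `¬ Rung2a₀Under (lawSigma S) 14` retires the `S ∧ KNI`-abiding
part of the PINNED door only: neither `Rung2a₀Origin 14` nor the law-free on-path `Rung2a₀ 14`. -/
theorem rung2a₀Origin_of_rung2a₀Under_lawSigma (S : DatumLaw) {h : ℤ} (h2a : Rung2a₀Under (lawSigma S) h) : Rung2a₀Origin h := by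
  obtain ⟨E₀, ψ₀, hE, hψ, δ, hΛ, hpos, hpass, hscope⟩ := h2a
  exact ⟨E₀, ψ₀, hE, hψ, δ, hΛ.2.1, hpos, hpass, hscope⟩

theorem rung2a₀_of_rung2a₀Under_lawSigma (S : DatumLaw) {h : ℤ} (h2a : Rung2a₀Under (lawSigma S) h) : Rung2a₀ h :=
  rung2a₀_of_rung2a₀Origin (rung2a₀Origin_of_rung2a₀Under_lawSigma S h2a)

/-- **THE HONEST CONVERSE**: off the law-restricted ansatz, every scope-guarded 2b₀ under that law holds VACUOUSLY. -/
theorem rung2b₀Under_of_not_rung2a₀Under {Λ : DatumLaw} {h : ℤ} {Rows : DepthBoundA4.Design → Prop} (hn : ¬ Rung2a₀Under Λ h) :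
    Rung2b₀Under Λ h Rows :=
  fun E₀ ψ₀ hE hψ δ hΛ hpos hpass hscope => absurd ⟨E₀, ψ₀, hE, hψ, δ, hΛ, hpos, hpass, hscope⟩ hn

/-- … hence, GIVEN THE CLOSED ROOM, 2b₀ of record under `Λ` ⟺ «no law-abiding 2a₀ datum at height 14» — the kernel-explicit reading of what a
proof of the row stubs buys once Leg A closes the v42 room (and why closed shells are refutation targets of 2b∘2a for the ansatz only). -/
theorem rung2b₀Lci_iff_not_rung2a₀Under_of_sPlus₀ {Λ : DatumLaw} {σ : DepthBoundA4.Design → ℤ} {π : ℤ}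
    (hS : SPlus₀ LeggedFloor.RuleD lawPP 14 σ π) : Rung2b₀Lci Λ σ π ↔ ¬ Rung2a₀Under Λ 14 :=
  ⟨fun h2b => not_rung2a₀Under_of_rung2b₀Lci h2b hS, rung2b₀Under_of_not_rung2a₀Under⟩

end KillPath

/-! ## §6 Audit -/

/-- AUDIT (v4, the (R-a) touch): this file decides nothing about `BlochSeedDiscOne` (18881), H2, HC_AV, HC_CM (HELD 3052), № 4, 26512, 19780 or HC;
`BlochSeedDiscOne_of` rests on the sorried RUNG 2a₀ (COSTUME DECLARED; `section OnPath` byte-identical to v3); the row stubs are off the crux path — four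
sorried under the `Pic⁰`-DECORATED ORIGIN PIN `originPicZeroLaw` (v42.4; v3: `originLaw` — exactly one guard token per stub changed, same slot, same names),
`stub_classRows` closed by citation; NO α1 stub (α1 is the hypothesis `Alpha1RowPinned W`, KEPT VERBATIM, resp. its decorated hypothesis shape
`Rung2b₀Under (lawPinnedPic (StaticAlongTW.StaticAlongTW W)) 14 RuleD` for the decorated records); every v3 name of §3–§5 is present with its v3 statement,
DERIVED from the re-guarded stubs via v42.4's `originPicZeroLaw_of_originLaw` ∕ `rung2b₀Under_originLaw_of_originPicZeroLaw` ∕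
`rung2b₀Under_sigma_originLaw_of_originPicZeroLaw S lawKNI` ∕ `rung2b₀Under_and_originLaw_of_originPicZeroLaw`; §3–§5 are sorry-free given the stubs and
hypothesis-carrying (law slot a PARAMETER, `S := StaticAlongTW.StaticAlongTW W` by decl name in the selector-fed records; no law is ever a row; no kill is
stated against `DatumLaw.trivial`; REACH = presentations pinned at the origin up to `Pic⁰`-decoration; relabel-invariance up to `Pic⁰`-decoration holds
UNCONDITIONALLY by the kernel theorems `OriginSep.originSeparating_holds` ∕ `OriginSep.originDecSeparating_holds` — sheaf8-1 g10 `OriginSeparatingReduction.lean`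
v2.1 9f3f39ac5dfbc894, officer AUDIT 139 ∕ 140 PLATES #118 ∕ #119 PASS, cited NOT imported).  `Lines/birth.lean` untouched.  `sorry` count: 5. -/
theorem audit_nothing_decided : True := trivial

end Summit.HodgeConjecture.HodgeConjecture.Cruxes.BlochSeedDiscOne.SplitBlock

end
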